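import Literature.RepresentationTheory.FiniteGroups.KLRGradedCellularBasisMurphyJM
import Literature.RepresentationTheory.FiniteGroups.KLRGradedCellularBasisKLRBraid
import HarnessLib

/-!
# Hu–Mathas' `ψ`-basis of `𝔽_p S_n` (level one) and the proof of `KLRGradedCellularBasis`

Main results: `exists_pairCong_psiElt` (Hu–Mathas' Lemma 46: `ψ_{𝔰𝔱} ≡ c m_{𝔰𝔱}` modulo higher
Murphy elements, `c ≠ 0`), `psiElt_mem_gradedBlock` (Lemma 44/45: `ψ_{𝔰𝔱} ∈ e_{cont λ} 𝔽_p[S_n]_{deg 𝔰 + deg 𝔱}`),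
`linearIndependent_psiElt`, `finrank_gradedBlock_eq_card` (the graded dimensions of the blocks of
`𝔽_p S_n`, i.e. the Main Theorem / Thm 49 at level one in the form needed), and the discharge
`KLRGradedCellularBasis_holds : KLRGradedCellularBasis`.


Continuation of `KLRGradedCellularBasisMurphyJM` (Murphy's basis `m_{𝔰𝔱}`, the dominance ideals
`J^{▷λ}`, the Jucys–Murphy triangularity) towards the graded dimension formula for the blocks of
`𝔽_p S_n` (Hu–Mathas 2010, Main Theorem at level one): the calculus of *leading terms*
`x ≡ c · m_{𝔰𝔱} (mod V(𝔰,𝔱))`, `V(𝔰,𝔱) = ∑_{(𝔲,𝔳) ≠ (𝔰,𝔱), 𝔲 ⊵ 𝔰, 𝔳 ⊵ 𝔱} m_{𝔲𝔳} + J^{▷λ}`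
(`pairUpper`, `PairCong`), under multiplication by the Jucys–Murphy elements, the KLR idempotents
`e(𝐢)`, the nilpotents `y_r`, Brundan–Kleshchev's `p_r(𝐢)`, `q_r(𝐢)^{±1}`, the transpositions
`s_r` along admissible steps, and finally Brundan–Kleshchev's `ψ_r` (`PairCong.mul_bkPsi`,
`PairCong.bkPsi_mul`: the triangularity of Hu–Mathas 2010, Lemma 46, at level one), the leading
term `e_λ y_λ ≡ c_λ x_λ` (their Cor. 42), the elements `ψ_{𝔰𝔱}` (Def. 43) with their leading terms
(Lemma 46) and degrees (Lemma 45), their linear independence, and the graded dimension formula for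
the blocks of `𝔽_p S_n` (Main Theorem / Thm 49 at level one) discharging `KLRGradedCellularBasis`.

## References

* J. Hu, A. Mathas, *Graded cellular bases for the cyclotomic Khovanov–Lauda–Rouquier algebras of
  type A*, Adv. Math. 225 (2010), arXiv:0907.2985, §3.3, §4.2–4.3, §5. [HuMathas2010]
* J. Brundan, A. Kleshchev, *Blocks of cyclotomic Hecke algebras and Khovanov–Lauda algebras*,
  Invent. Math. 178 (2009), §3. [BrundanKleshchev2009]
-/

noncomputable section

open scoped BigOperators

namespace Literature.RepresentationTheory.FiniteGroups

open Equiv Literature.NumberTheory.DiophantineGeometry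

/-! ### The two-sided error spaces `V(𝔰,𝔱)` and leading terms -/

section PairUpper

variable (R : Type*) [CommRing R] {n : ℕ} {μ : Nat.Partition n}

/-- **`V(𝔰,𝔱) = ∑ R m_{𝔲𝔳} + J^{▷λ}`** over the pairs `(𝔲,𝔳) ≠ (𝔰,𝔱)` of standard `λ`-tableaux with
`𝔲 ⊵ 𝔰`, `𝔳 ⊵ 𝔱`: the error space of the leading-term calculus. [folklore] -/
def pairUpper (s t : StdFilling n μ.youngDiagram) : Submodule R (MonoidAlgebra R (Perm (Fin n))) :=
  Submodule.span R {x | ∃ u v : StdFilling n μ.youngDiagram, FillingDominates u.1 s.1 ∧ FillingDominates v.1 t.1 ∧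
    (u ≠ s ∨ v ≠ t) ∧ x = murphy R u v} ⊔ domIdeal R μ.rowOf

/-- **`x ≡ c · m_{𝔰𝔱} (mod V(𝔰,𝔱))`**: `x` has leading term `c m_{𝔰𝔱}`. [folklore] -/
def PairCong (s t : StdFilling n μ.youngDiagram) (x : MonoidAlgebra R (Perm (Fin n))) (c : R) : Prop :=
  x - c • murphy R s t ∈ pairUpper R s t

/-- The Murphy generators of `V(𝔰,𝔱)`. [folklore] -/
theorem murphy_mem_pairUpper {s t u v : StdFilling n μ.youngDiagram} (hu : FillingDominates u.1 s.1)
    (hv : FillingDominates v.1 t.1) (hne : u ≠ s ∨ v ≠ t) : murphy R u v ∈ pairUpper R s t :=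
  Submodule.mem_sup_left (Submodule.subset_span ⟨u, v, hu, hv, hne, rfl⟩)

/-- `J^{▷λ} ⊆ V(𝔰,𝔱)`. [folklore] -/
theorem domIdeal_le_pairUpper (s t : StdFilling n μ.youngDiagram) : domIdeal R μ.rowOf ≤ pairUpper R s t :=
  le_sup_right

/-- `V(𝔰,𝔳) ⊆ V(𝔰,𝔳')` for `𝔳 ▷ 𝔳'`. [folklore] -/
theorem pairUpper_le_right (s : StdFilling n μ.youngDiagram) {v v' : StdFilling n μ.youngDiagram} (h : StdSDom v v') :
    pairUpper R s v ≤ pairUpper R s v' := by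
  refine sup_le_sup_right (Submodule.span_mono ?_) _
  rintro x ⟨u, w, hu, hw, -, rfl⟩
  exact ⟨u, w, hu, hw.trans h.1, Or.inr (StdSDom.of_dom_of_sdom hw h).2, rfl⟩

/-- `V(𝔲,𝔱) ⊆ V(𝔲',𝔱)` for `𝔲 ▷ 𝔲'`. [folklore] -/
theorem pairUpper_le_left {u u' : StdFilling n μ.youngDiagram} (t : StdFilling n μ.youngDiagram) (h : StdSDom u u') :
    pairUpper R u t ≤ pairUpper R u' t := by
  refine sup_le_sup_right (Submodule.span_mono ?_) _
  rintro x ⟨w, v, hw, hv, -, rfl⟩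
  exact ⟨w, v, hw.trans h.1, hv, Or.inl (StdSDom.of_dom_of_sdom hw h).2, rfl⟩

/-- `m_{𝔰𝔳} ∈ V(𝔰,𝔳')` for `𝔳 ▷ 𝔳'`. [folklore] -/
theorem murphy_mem_pairUpper_right (s : StdFilling n μ.youngDiagram) {v v' : StdFilling n μ.youngDiagram}
    (h : StdSDom v v') : murphy R s v ∈ pairUpper R s v' :=
  murphy_mem_pairUpper R (fillingDominates_refl _) h.1 (Or.inr h.2)

/-- `m_{𝔲𝔱} ∈ V(𝔲',𝔱)` for `𝔲 ▷ 𝔲'`. [folklore] -/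
theorem murphy_mem_pairUpper_left {u u' : StdFilling n μ.youngDiagram} (t : StdFilling n μ.youngDiagram)
    (h : StdSDom u u') : murphy R u t ∈ pairUpper R u' t :=
  murphy_mem_pairUpper R h.1 (fillingDominates_refl _) (Or.inl h.2)

/-- **`V(𝔰,𝔱)* = V(𝔱,𝔰)`** for the anti-involution `g ↦ g⁻¹` (`m_{𝔲𝔳}* = m_{𝔳𝔲}`, `J* = J`). [folklore] -/
theorem grpAlgStar_mem_pairUpper {s t : StdFilling n μ.youngDiagram} {x : MonoidAlgebra R (Perm (Fin n))}
    (hx : x ∈ pairUpper R s t) : grpAlgStar R x ∈ pairUpper R t s := by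
  obtain ⟨a, ha, b, hb, rfl⟩ := Submodule.mem_sup.1 hx
  rw [map_add]
  refine Submodule.add_mem _ (Submodule.mem_sup_left ?_) (Submodule.mem_sup_right (grpAlgStar_mem_domIdeal R hb))
  clear hx
  induction ha using Submodule.span_induction with
  | mem x hx =>
    obtain ⟨u, v, hu, hv, hne, rfl⟩ := hx
    rw [grpAlgStar_murphy]
    exact Submodule.subset_span ⟨v, u, hv, hu, hne.symm, rfl⟩
  | zero => rw [map_zero]; exact Submodule.zero_mem _
  | add x y _ _ hx hy => rw [map_add]; exact Submodule.add_mem _ hx hy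
  | smul c x _ hx => rw [map_smul]; exact Submodule.smul_mem _ c hx

variable {R}

/-- `x ≡ 0 · m_{𝔰𝔱}` means `x ∈ V(𝔰,𝔱)`. [folklore] -/
theorem pairCong_zero_iff {s t : StdFilling n μ.youngDiagram} {x : MonoidAlgebra R (Perm (Fin n))} :
    PairCong R s t x 0 ↔ x ∈ pairUpper R s t := by
  rw [PairCong, zero_smul, sub_zero]

/-- `m_{𝔰𝔱} ≡ 1 · m_{𝔰𝔱}`. [folklore] -/
theorem pairCong_murphy (s t : StdFilling n μ.youngDiagram) : PairCong R s t (murphy R s t) 1 := by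
  rw [PairCong, one_smul, sub_self]; exact Submodule.zero_mem _

/-- Leading terms add. [folklore] -/
theorem PairCong.add {s t : StdFilling n μ.youngDiagram} {x y : MonoidAlgebra R (Perm (Fin n))} {c d : R}
    (hx : PairCong R s t x c) (hy : PairCong R s t y d) : PairCong R s t (x + y) (c + d) := by
  rw [PairCong, add_smul, add_sub_add_comm]; exact Submodule.add_mem _ hx hy

/-- Leading terms subtract. [folklore] -/
theorem PairCong.sub {s t : StdFilling n μ.youngDiagram} {x y : MonoidAlgebra R (Perm (Fin n))} {c d : R}
    (hx : PairCong R s t x c) (hy : PairCong R s t y d) : PairCong R s t (x - y) (c - d) := by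
  rw [PairCong, sub_smul, sub_sub_sub_comm]; exact Submodule.sub_mem _ hx hy

/-- Leading terms negate. [folklore] -/
theorem PairCong.neg {s t : StdFilling n μ.youngDiagram} {x : MonoidAlgebra R (Perm (Fin n))} {c : R}
    (hx : PairCong R s t x c) : PairCong R s t (-x) (-c) := by
  rw [PairCong, neg_smul, sub_neg_eq_add, neg_add_eq_sub, ← neg_sub]; exact Submodule.neg_mem _ hx

/-- Leading terms scale. [folklore] -/
theorem PairCong.smul {s t : StdFilling n μ.youngDiagram} {x : MonoidAlgebra R (Perm (Fin n))} {c : R}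
    (hx : PairCong R s t x c) (a : R) : PairCong R s t (a • x) (a * c) := by
  rw [PairCong, ← smul_smul, ← smul_sub]; exact Submodule.smul_mem _ a hx

/-- Adding an error term. [folklore] -/
theorem PairCong.add_mem {s t : StdFilling n μ.youngDiagram} {x y : MonoidAlgebra R (Perm (Fin n))} {c : R}
    (hx : PairCong R s t x c) (hy : y ∈ pairUpper R s t) : PairCong R s t (x + y) c := by
  have := hx.add (pairCong_zero_iff.2 hy); rwa [add_zero] at this

/-- An element with a leading term at `(𝔰,𝔳)` is an error term at `(𝔰,𝔳')` for `𝔳 ▷ 𝔳'`. [folklore] -/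
theorem PairCong.mem_of_sdom_right {s v v' : StdFilling n μ.youngDiagram} {x : MonoidAlgebra R (Perm (Fin n))} {c : R}
    (hx : PairCong R s v x c) (h : StdSDom v v') : x ∈ pairUpper R s v' := by
  have := Submodule.add_mem _ (pairUpper_le_right R s h hx) (Submodule.smul_mem _ c (murphy_mem_pairUpper_right R s h))
  rwa [sub_add_cancel] at this

/-- An element with a leading term at `(𝔲,𝔱)` is an error term at `(𝔲',𝔱)` for `𝔲 ▷ 𝔲'`. [folklore] -/
theorem PairCong.mem_of_sdom_left {u u' t : StdFilling n μ.youngDiagram} {x : MonoidAlgebra R (Perm (Fin n))} {c : R}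
    (hx : PairCong R u t x c) (h : StdSDom u u') : x ∈ pairUpper R u' t := by
  have := Submodule.add_mem _ (pairUpper_le_left R t h hx) (Submodule.smul_mem _ c (murphy_mem_pairUpper_left R t h))
  rwa [sub_add_cancel] at this

/-- `*` swaps the indices of leading terms. [folklore] -/
theorem PairCong.star {s t : StdFilling n μ.youngDiagram} {x : MonoidAlgebra R (Perm (Fin n))} {c : R}
    (hx : PairCong R s t x c) : PairCong R t s (grpAlgStar R x) c := by
  have := grpAlgStar_mem_pairUpper R hx
  rwa [map_sub, map_smul, grpAlgStar_murphy] at this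

/-! #### Stability under the Jucys–Murphy elements -/

variable (R) in
/-- `U⁺(𝔲) w_𝔳⁻¹ ⊆ V(𝔰,𝔱)` for `𝔲 ⊵ 𝔰`, `𝔳 ⊵ 𝔱`. [folklore] -/
theorem map_upperSpan_le_pairUpper {s t u v : StdFilling n μ.youngDiagram} (hu : FillingDominates u.1 s.1)
    (hv : FillingDominates v.1 t.1) :
    (upperSpan R u).map (LinearMap.mulRight R (MonoidAlgebra.of R _ (wordPerm v)⁻¹)) ≤ pairUpper R s t := by
  rw [upperSpan, Submodule.map_span, Submodule.span_le]
  rintro x ⟨y, ⟨u'', hu'', rfl⟩, rfl⟩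
  rw [SetLike.mem_coe, LinearMap.mulRight_apply, ← murphy_eq_murphy_rowReading_mul]
  exact murphy_mem_pairUpper R (hu''.1.trans hu) hv (Or.inl (hu''.trans_dom hu).2)

variable (R) in
/-- **`L_k m_{𝔰𝔱} ≡ c_𝔰(k) m_{𝔰𝔱} (mod V(𝔰,𝔱))`.** [cite: HuMathas2010, §3.3 (3.7)] -/
theorem jucysMurphy_mul_murphy_sub_smul_mem_pairUpper (s t : StdFilling n μ.youngDiagram) (k : Fin n) :
    jucysMurphy R k * murphy R s t - jmContent R s k • murphy R s t ∈ pairUpper R s t :=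
  (sup_le (map_upperSpan_le_pairUpper R (fillingDominates_refl _) (fillingDominates_refl _)) (domIdeal_le_pairUpper R s t))
    (jucysMurphy_mul_murphy_sub_smul_mem' R s t k)

/-- **`L_k V(𝔰,𝔱) ⊆ V(𝔰,𝔱)`.** [folklore] -/
theorem jucysMurphy_mul_mem_pairUpper {s t : StdFilling n μ.youngDiagram} (k : Fin n) {x : MonoidAlgebra R (Perm (Fin n))}
    (hx : x ∈ pairUpper R s t) : jucysMurphy R k * x ∈ pairUpper R s t := by
  obtain ⟨a, ha, b, hb, rfl⟩ := Submodule.mem_sup.1 hx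
  rw [mul_add]
  refine Submodule.add_mem _ ?_ (Submodule.mem_sup_right (mul_mem_domIdeal_left R _ hb))
  clear hx
  induction ha using Submodule.span_induction with
  | mem x hx =>
    obtain ⟨u, v, hu, hv, hne, rfl⟩ := hx
    rw [← sub_add_cancel (jucysMurphy R k * murphy R u v) (jmContent R u k • murphy R u v)]
    exact Submodule.add_mem _ ((sup_le (map_upperSpan_le_pairUpper R hu hv) (domIdeal_le_pairUpper R s t))
      (jucysMurphy_mul_murphy_sub_smul_mem' R u v k))
      (Submodule.smul_mem _ _ (murphy_mem_pairUpper R hu hv hne))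
  | zero => rw [mul_zero]; exact Submodule.zero_mem _
  | add x y _ _ hx hy => rw [mul_add]; exact Submodule.add_mem _ hx hy
  | smul c x _ hx => rw [mul_smul_comm]; exact Submodule.smul_mem _ c hx

/-- **`V(𝔰,𝔱) L_k ⊆ V(𝔰,𝔱)`** (by `*`). [folklore] -/
theorem mul_jucysMurphy_mem_pairUpper {s t : StdFilling n μ.youngDiagram} (k : Fin n) {x : MonoidAlgebra R (Perm (Fin n))}
    (hx : x ∈ pairUpper R s t) : x * jucysMurphy R k ∈ pairUpper R s t := by
  have := grpAlgStar_mem_pairUpper R (jucysMurphy_mul_mem_pairUpper k (grpAlgStar_mem_pairUpper R hx))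
  rwa [grpAlgStar_mul, grpAlgStar_jucysMurphy_comm, grpAlgStar_grpAlgStar] at this

/-- **`L_k x ≡ c_𝔰(k) c · m_{𝔰𝔱}` if `x ≡ c · m_{𝔰𝔱}`.** [cite: HuMathas2010, §3.3 (3.7)] -/
theorem PairCong.jucysMurphy_mul {s t : StdFilling n μ.youngDiagram} {x : MonoidAlgebra R (Perm (Fin n))} {c : R}
    (hx : PairCong R s t x c) (k : Fin n) : PairCong R s t (jucysMurphy R k * x) (jmContent R s k * c) := by
  have e : jucysMurphy R k * (x - c • murphy R s t) + c • (jucysMurphy R k * murphy R s t - jmContent R s k • murphy R s t) =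
      jucysMurphy R k * x - (jmContent R s k * c) • murphy R s t := by
    rw [mul_sub, mul_smul_comm, smul_sub, smul_smul, mul_comm c, sub_add_sub_cancel]
  have := Submodule.add_mem _ (jucysMurphy_mul_mem_pairUpper k hx)
    (Submodule.smul_mem _ c (jucysMurphy_mul_murphy_sub_smul_mem_pairUpper R s t k))
  rw [e] at this
  exact this

/-- **`x L_k ≡ c_𝔱(k) c · m_{𝔰𝔱}` if `x ≡ c · m_{𝔰𝔱}`** (by `*`). [cite: HuMathas2010, §3.3 (3.7)] -/
theorem PairCong.mul_jucysMurphy {s t : StdFilling n μ.youngDiagram} {x : MonoidAlgebra R (Perm (Fin n))} {c : R}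
    (hx : PairCong R s t x c) (k : Fin n) : PairCong R s t (x * jucysMurphy R k) (jmContent R t k * c) := by
  have := (hx.star.jucysMurphy_mul k).star
  rwa [grpAlgStar_mul, grpAlgStar_jucysMurphy_comm, grpAlgStar_grpAlgStar] at this

/-- `x L_r - c_𝔱(r) x ∈ V(𝔰,𝔱)` if `x ≡ c · m_{𝔰𝔱}`. [folklore] -/
theorem PairCong.mul_jucysMurphy_sub_smul_mem {s t : StdFilling n μ.youngDiagram} {x : MonoidAlgebra R (Perm (Fin n))} {c : R}
    (hx : PairCong R s t x c) (r : Fin n) : x * jucysMurphy R r - jmContent R t r • x ∈ pairUpper R s t := by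
  have e : x * jucysMurphy R r - jmContent R t r • x =
      (x * jucysMurphy R r - (jmContent R t r * c) • murphy R s t) - jmContent R t r • (x - c • murphy R s t) := by
    rw [smul_sub, smul_smul, sub_sub_sub_cancel_right]
  rw [e]; exact Submodule.sub_mem _ (hx.mul_jucysMurphy r) (Submodule.smul_mem _ _ hx)

/-- `L_r x - c_𝔰(r) x ∈ V(𝔰,𝔱)` if `x ≡ c · m_{𝔰𝔱}`. [folklore] -/
theorem PairCong.jucysMurphy_mul_sub_smul_mem {s t : StdFilling n μ.youngDiagram} {x : MonoidAlgebra R (Perm (Fin n))} {c : R}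
    (hx : PairCong R s t x c) (r : Fin n) : jucysMurphy R r * x - jmContent R s r • x ∈ pairUpper R s t := by
  have e : jucysMurphy R r * x - jmContent R s r • x =
      (jucysMurphy R r * x - (jmContent R s r * c) • murphy R s t) - jmContent R s r • (x - c • murphy R s t) := by
    rw [smul_sub, smul_smul, sub_sub_sub_cancel_right]
  rw [e]; exact Submodule.sub_mem _ (hx.jucysMurphy_mul r) (Submodule.smul_mem _ _ hx)

/-! #### Transport along an admissible step `𝔳 → 𝔳 ∘ s_r` -/

/-- **`s_r V(𝔳,𝔰) ⊆ V(𝔳 ∘ s_r, 𝔰)` along an admissible step** (`r` strictly above `r+1` in `𝔳`):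
straighten the left factor of `s_r m_{𝔴𝔲}` and lift the dominance `𝔴 ⊵ 𝔳` through `s_r`; the
tableau `𝔳 ∘ s_r` itself only arises from `𝔴 = 𝔳`. [folklore] -/
theorem of_swap_mul_mem_pairUpper {v v' s : StdFilling n μ.youngDiagram} {r r' : Fin n} (h : (r' : ℕ) = r + 1)
    (hv' : v'.1 = v.1 ∘ ⇑(swap r r')) (hrow : (v.1 r).1 < (v.1 r').1) {x : MonoidAlgebra R (Perm (Fin n))}
    (hx : x ∈ pairUpper R v s) : MonoidAlgebra.of R _ (swap r r') * x ∈ pairUpper R v' s := by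
  obtain ⟨a, ha, b, hb, rfl⟩ := Submodule.mem_sup.1 hx
  rw [mul_add]
  refine Submodule.add_mem _ ?_ (Submodule.mem_sup_right (of_mul_mem_domIdeal R _ hb))
  clear hx
  induction ha using Submodule.span_induction with
  | mem x hx =>
    obtain ⟨w, u, hw, hu, hne, rfl⟩ := hx
    have key := of_mul_murphyX_mem_stdSpan_sup R μ (swap r r' * wordPerm w)
    rw [rowFunOf_mul, swap_inv, rowFunOf_wordPerm] at key
    obtain ⟨a₁, ha₁, b₁, hb₁, hab⟩ := Submodule.mem_sup.1 key
    have hlift : FillingDominates (toFill ((fun e => (w.1 e).1) ∘ ⇑(swap r r'))) (toFill fun e => (v'.1 e).1) := by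
      have h1 := (fillingDominates_toFill_iff _ _).2 (fillingDominates_comp_swap h hw hrow)
      rw [← hv'] at h1
      exact h1
    rw [murphy_eq_murphy_rowReading_mul R w u, ← mul_assoc, murphy, wordPerm_rowReading, inv_one, map_one, mul_one,
      ← mul_assoc, ← map_mul, ← hab, add_mul]
    refine Submodule.add_mem _ (Submodule.mem_sup_left ?_) (Submodule.mem_sup_right (mul_of_mem_domIdeal R _ hb₁))
    have hle : (stdSpan R μ ((fun e => (w.1 e).1) ∘ ⇑(swap r r'))).map
        (LinearMap.mulRight R (MonoidAlgebra.of R _ (wordPerm u)⁻¹)) ≤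
        Submodule.span R {x | ∃ u₁ v₁ : StdFilling n μ.youngDiagram, FillingDominates u₁.1 v'.1 ∧
          FillingDominates v₁.1 s.1 ∧ (u₁ ≠ v' ∨ v₁ ≠ s) ∧ x = murphy R u₁ v₁} := by
      rw [stdSpan, Submodule.map_span, Submodule.span_le]
      rintro x ⟨y, ⟨w'', hw'', rfl⟩, rfl⟩
      rw [SetLike.mem_coe, LinearMap.mulRight_apply, ← murphy_eq_murphy_rowReading_mul]
      refine Submodule.subset_span ⟨w'', u, (fillingDominates_toFill_iff _ _).1 (hw''.trans hlift), hu, ?_, rfl⟩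
      rcases hne with hne | hne
      · refine Or.inl fun he => hne ?_
        rw [he] at hw''
        refine StdFilling.ext_of_row_eq μ.card_cells_youngDiagram fun e => ?_
        have hrows := hlift.row_eq hw'' (swap r r' e)
        simp only [toFill_fst, Function.comp_apply, swap_apply_self] at hrows
        rw [hrows, hv', Function.comp_apply, swap_apply_self]
      · exact Or.inr hne
    exact hle ⟨a₁, ha₁, rfl⟩
  | zero => rw [mul_zero]; exact Submodule.zero_mem _
  | add x y _ _ hx hy => rw [mul_add]; exact Submodule.add_mem _ hx hy
  | smul c x _ hx => rw [mul_smul_comm]; exact Submodule.smul_mem _ c hx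

variable (R) in
/-- `m_{𝔳'𝔰} = s_r m_{𝔳𝔰}` for `𝔳' = 𝔳 ∘ s_r`. [folklore] -/
theorem murphy_of_comp_swap_left {v v' : StdFilling n μ.youngDiagram} (s : StdFilling n μ.youngDiagram) {r r' : Fin n}
    (hv' : v'.1 = v.1 ∘ ⇑(swap r r')) :
    murphy R v' s = MonoidAlgebra.of R _ (swap r r') * murphy R v s := by
  rw [murphy_eq_murphy_rowReading_mul R v' s, murphy_rowReading_of_comp_swap R hv', mul_assoc,
    ← murphy_eq_murphy_rowReading_mul]

variable (R) in
/-- `m_{𝔰𝔳'} = m_{𝔰𝔳} s_r` for `𝔳' = 𝔳 ∘ s_r`. [folklore] -/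
theorem murphy_of_comp_swap_right (s : StdFilling n μ.youngDiagram) {v v' : StdFilling n μ.youngDiagram} {r r' : Fin n}
    (hv' : v'.1 = v.1 ∘ ⇑(swap r r')) :
    murphy R s v' = murphy R s v * MonoidAlgebra.of R _ (swap r r') := by
  apply (grpAlgStar R (G := Perm (Fin n))).injective
  rw [grpAlgStar_murphy, grpAlgStar_mul, grpAlgStar_of, swap_inv, grpAlgStar_murphy, murphy_of_comp_swap_left R s hv']

/-- **`s_r x ≡ c · m_{𝔳'𝔰} (mod V(𝔳',𝔰))` if `x ≡ c · m_{𝔳𝔰} (mod V(𝔳,𝔰))`**, along an admissible step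
`𝔳 → 𝔳' = 𝔳 ∘ s_r`. [folklore] -/
theorem PairCong.of_swap_mul {v v' s : StdFilling n μ.youngDiagram} {x : MonoidAlgebra R (Perm (Fin n))} {c : R}
    (hx : PairCong R v s x c) {r r' : Fin n} (h : (r' : ℕ) = r + 1) (hv' : v'.1 = v.1 ∘ ⇑(swap r r'))
    (hrow : (v.1 r).1 < (v.1 r').1) : PairCong R v' s (MonoidAlgebra.of R _ (swap r r') * x) c := by
  have := of_swap_mul_mem_pairUpper h hv' hrow hx
  rw [mul_sub, mul_smul_comm, ← murphy_of_comp_swap_left R s hv'] at this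
  exact this

/-- **`x s_r ≡ c · m_{𝔰𝔳'} (mod V(𝔰,𝔳'))` if `x ≡ c · m_{𝔰𝔳} (mod V(𝔰,𝔳))`** (by `*`). [folklore] -/
theorem PairCong.mul_of_swap {s v v' : StdFilling n μ.youngDiagram} {x : MonoidAlgebra R (Perm (Fin n))} {c : R}
    (hx : PairCong R s v x c) {r r' : Fin n} (h : (r' : ℕ) = r + 1) (hv' : v'.1 = v.1 ∘ ⇑(swap r r'))
    (hrow : (v.1 r).1 < (v.1 r').1) : PairCong R s v' (x * MonoidAlgebra.of R _ (swap r r')) c := by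
  have := (hx.star.of_swap_mul h hv' hrow).star
  rwa [grpAlgStar_mul, grpAlgStar_of, swap_inv, grpAlgStar_grpAlgStar] at this

/-- `V(𝔰,𝔳) s_r ⊆ V(𝔰,𝔳')`. [folklore] -/
theorem mul_of_swap_mem_pairUpper {s v v' : StdFilling n μ.youngDiagram} {x : MonoidAlgebra R (Perm (Fin n))}
    (hx : x ∈ pairUpper R s v) {r r' : Fin n} (h : (r' : ℕ) = r + 1) (hv' : v'.1 = v.1 ∘ ⇑(swap r r'))
    (hrow : (v.1 r).1 < (v.1 r').1) : x * MonoidAlgebra.of R _ (swap r r') ∈ pairUpper R s v' := by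
  rw [← pairCong_zero_iff] at hx ⊢; exact hx.mul_of_swap h hv' hrow

end PairUpper


/-! ### The calculus over a field: idempotents, nilpotents, `p_r`, `q_r^{±1}`, `ψ_r` -/

section FieldCalc

variable (k : Type*) [Field k] [DecidableEq k] {n : ℕ} {μ : Nat.Partition n}

omit [DecidableEq k] in
/-- **The content sequence `(c_𝔱(0), …, c_𝔱(n-1))` of `𝔱` in `k`** (for `k = 𝔽_p` its residue
sequence `𝐢^𝔱`). [folklore] -/
def contSeq {Y : YoungDiagram} (t : StdFilling n Y) : Fin n → k := fun r => jmContent k t r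

omit [DecidableEq k] in
/-- Unfolding `contSeq`. [folklore] -/
theorem contSeq_apply {Y : YoungDiagram} (t : StdFilling n Y) (r : Fin n) : contSeq k t r = jmContent k t r := rfl

omit [DecidableEq k] in
/-- In a standard tableau the entry `r` lies in a row and a column `≤ r` (the shape of the entries
`≤ r` is a lower set with `≤ r + 1` cells). [folklore] -/
theorem cell_le_of_stdFilling {Y : YoungDiagram} (hn : Y.cells.card = n) (T : StdFilling n Y) (r : Fin n) :
    (T.1 r).1 ≤ r ∧ (T.1 r).2 ≤ r := by
  have hlow := isCellLowerSet_prefixCells hn T r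
  have hmemr : T.1 r ∈ prefixCells T.1 r := Finset.mem_image.2 ⟨r, Finset.mem_filter.2 ⟨Finset.mem_univ _, le_rfl⟩, rfl⟩
  have hcard : (prefixCells T.1 r).card ≤ r + 1 := by
    rw [prefixCells]
    refine Finset.card_image_le.trans ?_
    rw [show (Finset.univ.filter fun j : Fin n => j ≤ r) = Finset.Iic r by ext j; simp, Fin.card_Iic]
  constructor
  · have hsub : (Finset.range ((T.1 r).1 + 1)).image (fun a' => (a', (T.1 r).2)) ⊆ prefixCells T.1 r := by
      intro x hx
      obtain ⟨a', ha', rfl⟩ := Finset.mem_image.1 hx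
      exact hlow hmemr (by have := Finset.mem_range.1 ha'; simp only; omega) le_rfl
    have h := (Finset.card_le_card hsub).trans hcard
    rw [Finset.card_image_of_injective _ (fun x y h => by simpa using h), Finset.card_range] at h
    omega
  · have hsub : (Finset.range ((T.1 r).2 + 1)).image (fun b' => ((T.1 r).1, b')) ⊆ prefixCells T.1 r := by
      intro x hx
      obtain ⟨b', hb', rfl⟩ := Finset.mem_image.1 hx
      exact hlow hmemr le_rfl (by have := Finset.mem_range.1 hb'; simp only; omega)
    have h := (Finset.card_le_card hsub).trans hcard
    rw [Finset.card_image_of_injective _ (fun x y h => by simpa using h), Finset.card_range] at h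
    omega

/-- The content sequence of a standard tableau is a candidate residue sequence. [folklore] -/
theorem contSeq_mem_residueSeqs (t : StdFilling n μ.youngDiagram) : contSeq k t ∈ residueSeqs k n := by
  rw [residueSeqs, Fintype.mem_piFinset]
  intro r
  obtain ⟨hrow, hcol⟩ := cell_le_of_stdFilling μ.card_cells_youngDiagram t r
  refine Finset.mem_image.2 ⟨((t.1 r).2 : ℤ) - (t.1 r).1, Finset.mem_Icc.2 ⟨by omega, by omega⟩, ?_⟩
  simp only [contSeq, jmContent]
  push_cast
  ring

variable {k}

/-! #### Idempotents -/

/-- **`V(𝔰,𝔱) e(𝐣) ⊆ V(𝔰,𝔱)`** (the `e(𝐣)` are polynomials in the `L_r`). [folklore] -/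
theorem mul_klrIdempotent_mem_pairUpper {s t : StdFilling n μ.youngDiagram} {x : MonoidAlgebra k (Perm (Fin n))}
    (hx : x ∈ pairUpper k s t) (χ : Fin n → k) : x * klrIdempotent k χ ∈ pairUpper k s t := by
  have h := mul_klrIdempotent_sub_mem (N := pairUpper k s t) (fun r _ hy => mul_jucysMurphy_mem_pairUpper r hy) (χ := χ)
    (fun r => Submodule.sub_mem _ (mul_jucysMurphy_mem_pairUpper r hx) (Submodule.smul_mem _ _ hx))
  have := Submodule.add_mem _ h hx
  rwa [sub_add_cancel] at this

/-- **`e(𝐣) V(𝔰,𝔱) ⊆ V(𝔰,𝔱)`** (by `*`). [folklore] -/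
theorem klrIdempotent_mul_mem_pairUpper {s t : StdFilling n μ.youngDiagram} {x : MonoidAlgebra k (Perm (Fin n))}
    (hx : x ∈ pairUpper k s t) (χ : Fin n → k) : klrIdempotent k χ * x ∈ pairUpper k s t := by
  have := grpAlgStar_mem_pairUpper k (mul_klrIdempotent_mem_pairUpper (grpAlgStar_mem_pairUpper k hx) χ)
  rwa [grpAlgStar_mul, grpAlgStar_klrIdempotent, grpAlgStar_grpAlgStar] at this

/-- **`x e(𝐢^𝔱) ≡ c · m_{𝔰𝔱}` if `x ≡ c · m_{𝔰𝔱}`** (Hu–Mathas 2010, proof of Prop. 35 / Lemma 4.4).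
[cite: HuMathas2010, §4.2] -/
theorem PairCong.mul_klrIdempotent_self {s t : StdFilling n μ.youngDiagram} {x : MonoidAlgebra k (Perm (Fin n))} {c : k}
    (hx : PairCong k s t x c) : PairCong k s t (x * klrIdempotent k (contSeq k t)) c := by
  have h := mul_klrIdempotent_sub_mem (N := pairUpper k s t) (fun r _ hy => mul_jucysMurphy_mem_pairUpper r hy)
    (x := x) (χ := contSeq k t) (fun r => hx.mul_jucysMurphy_sub_smul_mem r)
  have := Submodule.add_mem _ h hx
  rw [sub_add_sub_cancel] at this
  exact this

/-- **`x e(𝐣) ∈ V(𝔰,𝔱)` for `𝐣 ≠ 𝐢^𝔱` if `x ≡ c · m_{𝔰𝔱}`.** [cite: HuMathas2010, §4.2] -/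
theorem PairCong.mul_klrIdempotent_of_ne {s t : StdFilling n μ.youngDiagram} {x : MonoidAlgebra k (Perm (Fin n))} {c : k}
    (hx : PairCong k s t x c) {χ : Fin n → k} (hne : χ ≠ contSeq k t) : x * klrIdempotent k χ ∈ pairUpper k s t :=
  mul_klrIdempotent_mem_of_ne (N := pairUpper k s t) (fun r _ hy => mul_jucysMurphy_mem_pairUpper r hy)
    (contSeq_mem_residueSeqs k t) (fun r => hx.mul_jucysMurphy_sub_smul_mem r) hne

/-- **`e(𝐢^𝔰) x ≡ c · m_{𝔰𝔱}` if `x ≡ c · m_{𝔰𝔱}`** (by `*`). [cite: HuMathas2010, §4.2] -/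
theorem PairCong.klrIdempotent_self_mul {s t : StdFilling n μ.youngDiagram} {x : MonoidAlgebra k (Perm (Fin n))} {c : k}
    (hx : PairCong k s t x c) : PairCong k s t (klrIdempotent k (contSeq k s) * x) c := by
  have := hx.star.mul_klrIdempotent_self.star
  rwa [grpAlgStar_mul, grpAlgStar_klrIdempotent, grpAlgStar_grpAlgStar] at this

/-- **`e(𝐣) x ∈ V(𝔰,𝔱)` for `𝐣 ≠ 𝐢^𝔰` if `x ≡ c · m_{𝔰𝔱}`** (by `*`). [cite: HuMathas2010, §4.2] -/
theorem PairCong.klrIdempotent_mul_of_ne {s t : StdFilling n μ.youngDiagram} {x : MonoidAlgebra k (Perm (Fin n))} {c : k}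
    (hx : PairCong k s t x c) {χ : Fin n → k} (hne : χ ≠ contSeq k s) : klrIdempotent k χ * x ∈ pairUpper k s t := by
  have := grpAlgStar_mem_pairUpper k (hx.star.mul_klrIdempotent_of_ne hne)
  rwa [grpAlgStar_mul, grpAlgStar_klrIdempotent, grpAlgStar_grpAlgStar] at this

/-! #### Nilpotents and the units `c + y_r - y_{r'}` -/

variable (k) in
/-- `y_r* = y_r`. [folklore] -/
theorem grpAlgStar_bkNilpotent (r : Fin n) : grpAlgStar k (bkNilpotent k r) = bkNilpotent k r := by
  rw [bkNilpotent, map_sum]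
  refine Finset.sum_congr rfl fun χ _ => ?_
  rw [map_sub, map_smul, grpAlgStar_mul, grpAlgStar_klrIdempotent, grpAlgStar_jucysMurphy, ← jucysMurphy_mul_klrIdempotent]

/-- **`x y_r ∈ V(𝔰,𝔱)` if `x ≡ c · m_{𝔰𝔱}`**: `y_r = L_r - ∑_𝐣 j_r e(𝐣)` and both `x L_r` and
`i^𝔱_r x e(𝐢^𝔱)` have leading term `c_𝔱(r) c m_{𝔰𝔱}` (Hu–Mathas 2010, Lemma 4.4 / Prop. 35: the
`y_r` act nilpotently upper-triangularly). [cite: HuMathas2010, §4.2] -/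
theorem PairCong.mul_bkNilpotent {s t : StdFilling n μ.youngDiagram} {x : MonoidAlgebra k (Perm (Fin n))} {c : k}
    (hx : PairCong k s t x c) (r : Fin n) : x * bkNilpotent k r ∈ pairUpper k s t := by
  have hy : bkNilpotent k r = jucysMurphy k r - ∑ χ ∈ residueSeqs k n, χ r • klrIdempotent k χ :=
    eq_sub_of_add_eq (jucysMurphy_eq_bkNilpotent_add k r).symm
  have hsum : ∑ χ ∈ residueSeqs k n, x * (χ r • klrIdempotent k χ) - (jmContent k t r * c) • murphy k s t ∈ pairUpper k s t := by
    rw [← Finset.add_sum_erase _ _ (contSeq_mem_residueSeqs k t), add_sub_right_comm]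
    refine Submodule.add_mem _ ?_ (Submodule.sum_mem _ fun χ hχ => ?_)
    · rw [mul_smul_comm, contSeq_apply, ← smul_smul, ← smul_sub]
      exact Submodule.smul_mem _ _ hx.mul_klrIdempotent_self
    · rw [mul_smul_comm]; exact Submodule.smul_mem _ _ (hx.mul_klrIdempotent_of_ne (Finset.mem_erase.1 hχ).1)
  have := Submodule.sub_mem _ (hx.mul_jucysMurphy r) hsum
  rw [sub_sub_sub_cancel_right] at this
  rw [hy, mul_sub, Finset.mul_sum]
  exact this

/-- `V(𝔰,𝔱) y_r ⊆ V(𝔰,𝔱)`. [folklore] -/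
theorem mul_bkNilpotent_mem_pairUpper {s t : StdFilling n μ.youngDiagram} {x : MonoidAlgebra k (Perm (Fin n))}
    (hx : x ∈ pairUpper k s t) (r : Fin n) : x * bkNilpotent k r ∈ pairUpper k s t :=
  (pairCong_zero_iff.2 hx).mul_bkNilpotent r

/-- `y_r x ∈ V(𝔰,𝔱)` if `x ≡ c · m_{𝔰𝔱}` (by `*`). [cite: HuMathas2010, §4.2] -/
theorem PairCong.bkNilpotent_mul {s t : StdFilling n μ.youngDiagram} {x : MonoidAlgebra k (Perm (Fin n))} {c : k}
    (hx : PairCong k s t x c) (r : Fin n) : bkNilpotent k r * x ∈ pairUpper k s t := by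
  have := grpAlgStar_mem_pairUpper k (hx.star.mul_bkNilpotent r)
  rwa [grpAlgStar_mul, grpAlgStar_bkNilpotent, grpAlgStar_grpAlgStar] at this

/-- **`x (a + y_r - y_{r'}) ≡ a c · m_{𝔰𝔱}` if `x ≡ c · m_{𝔰𝔱}`.** [folklore] -/
theorem PairCong.mul_bkDiffUnit {s t : StdFilling n μ.youngDiagram} {x : MonoidAlgebra k (Perm (Fin n))} {c : k}
    (hx : PairCong k s t x c) (r r' : Fin n) (a : k) : PairCong k s t (x * bkDiffUnit k r r' a) (c * a) := by
  rw [bkDiffUnit, mul_add, mul_sub, ← Algebra.commutes, ← Algebra.smul_def]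
  have h1 : PairCong k s t (a • x) (c * a) := by rw [mul_comm]; exact hx.smul a
  exact h1.add_mem (Submodule.sub_mem _ (hx.mul_bkNilpotent r) (hx.mul_bkNilpotent r'))

/-- `V(𝔰,𝔱) (a + y_r - y_{r'}) ⊆ V(𝔰,𝔱)`. [folklore] -/
theorem mul_bkDiffUnit_mem_pairUpper {s t : StdFilling n μ.youngDiagram} {x : MonoidAlgebra k (Perm (Fin n))}
    (hx : x ∈ pairUpper k s t) (r r' : Fin n) (a : k) : x * bkDiffUnit k r r' a ∈ pairUpper k s t := by
  have := (pairCong_zero_iff.2 hx).mul_bkDiffUnit r r' a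
  rwa [zero_mul, pairCong_zero_iff] at this

/-! #### Inverses of units -/

omit [DecidableEq k] in
/-- **A subspace stable under a unit `D` is stable under `D⁻¹`** (right multiplication by `D` is an
injective, hence surjective, endomorphism of the finite-dimensional subspace). [folklore] -/
theorem mul_ringInverse_mem_of_isUnit {N : Submodule k (MonoidAlgebra k (Perm (Fin n)))} {D : MonoidAlgebra k (Perm (Fin n))}
    (hD : IsUnit D) (hN : ∀ y ∈ N, y * D ∈ N) {x : MonoidAlgebra k (Perm (Fin n))} (hx : x ∈ N) :
    x * Ring.inverse D ∈ N := by
  let φ : N →ₗ[k] N := (LinearMap.mulRight k D).restrict fun y hy => hN y hy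
  have hinj : Function.Injective φ := by
    intro y₁ y₂ he
    apply Subtype.ext
    have h' : (y₁ : MonoidAlgebra k (Perm (Fin n))) * D = y₂ * D := by
      have := congrArg Subtype.val he
      simpa only [φ, LinearMap.coe_restrict_apply, LinearMap.mulRight_apply] using this
    calc (y₁ : MonoidAlgebra k (Perm (Fin n))) = y₁ * D * Ring.inverse D := (Ring.mul_inverse_cancel_right _ _ hD).symm
      _ = y₂ * D * Ring.inverse D := by rw [h']
      _ = y₂ := Ring.mul_inverse_cancel_right _ _ hD
  obtain ⟨y, hy⟩ := LinearMap.surjective_of_injective hinj ⟨x, hx⟩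
  have hyD : (y : MonoidAlgebra k (Perm (Fin n))) * D = x := by
    have := congrArg Subtype.val hy
    simpa only [φ, LinearMap.coe_restrict_apply, LinearMap.mulRight_apply] using this
  rw [← hyD, Ring.mul_inverse_cancel_right _ _ hD]
  exact y.2

omit [DecidableEq k] in
/-- **Dividing a leading term by a unit**: if `V(𝔰,𝔱) D ⊆ V(𝔰,𝔱)`, `m_{𝔰𝔱} D ≡ d · m_{𝔰𝔱}` with
`d ≠ 0` and `x ≡ c · m_{𝔰𝔱}`, then `x D⁻¹ ≡ c d⁻¹ · m_{𝔰𝔱}`. [folklore] -/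
theorem PairCong.mul_ringInverse {s t : StdFilling n μ.youngDiagram} {x : MonoidAlgebra k (Perm (Fin n))} {c : k}
    (hx : PairCong k s t x c) {D : MonoidAlgebra k (Perm (Fin n))} (hD : IsUnit D)
    (hN : ∀ y ∈ pairUpper k s t, y * D ∈ pairUpper k s t) {d : k} (hd : d ≠ 0) (hm : PairCong k s t (murphy k s t * D) d) :
    PairCong k s t (x * Ring.inverse D) (c * d⁻¹) := by
  have hz : (x * Ring.inverse D - (c * d⁻¹) • murphy k s t) * D ∈ pairUpper k s t := by
    have e : (x * Ring.inverse D - (c * d⁻¹) • murphy k s t) * D =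
        (x - c • murphy k s t) - (c * d⁻¹) • (murphy k s t * D - d • murphy k s t) := by
      rw [sub_mul, Ring.inverse_mul_cancel_right _ _ hD, smul_mul_assoc, smul_sub, smul_smul, mul_assoc c,
        inv_mul_cancel₀ hd, mul_one]
      abel
    rw [e]; exact Submodule.sub_mem _ hx (Submodule.smul_mem _ _ hm)
  have := mul_ringInverse_mem_of_isUnit hD hN hz
  rw [Ring.mul_inverse_cancel_right _ _ hD] at this
  exact this

variable (k) in
omit [DecidableEq k] in
/-- `(D⁻¹)* = (D*)⁻¹` for units `D`. [folklore] -/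
theorem grpAlgStar_ringInverse {D : MonoidAlgebra k (Perm (Fin n))} (hD : IsUnit D) :
    grpAlgStar k (Ring.inverse D) = Ring.inverse (grpAlgStar k D) := by
  have h1 : grpAlgStar k (Ring.inverse D) * grpAlgStar k D = 1 := by
    rw [← grpAlgStar_mul, Ring.mul_inverse_cancel _ hD, grpAlgStar_one]
  have h2 : grpAlgStar k D * grpAlgStar k (Ring.inverse D) = 1 := by
    rw [← grpAlgStar_mul, Ring.inverse_mul_cancel _ hD, grpAlgStar_one]
  have hu : IsUnit (grpAlgStar k D) := isUnit_iff_exists.2 ⟨_, h2, h1⟩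
  rw [← one_mul (Ring.inverse (grpAlgStar k D)), Ring.eq_mul_inverse_iff_mul_eq _ _ _ hu]
  exact h1

/-! #### Brundan–Kleshchev's `p_r(𝐢)` and `q_r(𝐢)` -/

variable (k) in
/-- The scalar by which `p_r(𝐢)` acts on leading terms: `1` if `i_r = i_{r+1}`, else `(i_r - i_{r+1})⁻¹`.
[folklore] -/
def bkPScalar (r r' : Fin n) (χ : Fin n → k) : k := if χ r = χ r' then 1 else (χ r - χ r')⁻¹

variable (k) in
/-- The scalar by which `q_r(𝐢)` acts on leading terms (case by case as in `bkQ`). [folklore] -/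
def bkQScalar (r r' : Fin n) (χ : Fin n → k) : k :=
  if χ r = χ r' then 1
  else if χ r' = χ r + 1 then
    (if χ r = χ r' + 1 then -bkPScalar k r r' χ else bkPScalar k r r' χ * bkPScalar k r r' χ - bkPScalar k r r' χ)
  else (if χ r = χ r' + 1 then 1 else 1 - bkPScalar k r r' χ)

variable (k) in
/-- `bkPScalar ≠ 0`. [folklore] -/
theorem bkPScalar_ne_zero (r r' : Fin n) (χ : Fin n → k) : bkPScalar k r r' χ ≠ 0 := by
  unfold bkPScalar
  split_ifs with h
  · exact one_ne_zero
  · exact inv_ne_zero (sub_ne_zero.2 h)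

variable (k) in
/-- **`bkQScalar ≠ 0`** (the same case analysis as the invertibility of `q_r(𝐢)`). [folklore] -/
theorem bkQScalar_ne_zero (r r' : Fin n) (χ : Fin n → k) : bkQScalar k r r' χ ≠ 0 := by
  have hp : ¬ χ r = χ r' → bkPScalar k r r' χ = (χ r - χ r')⁻¹ := fun h => by rw [bkPScalar, if_neg h]
  have key : ¬ χ r = χ r' → ¬ χ r = χ r' + 1 → (χ r - χ r')⁻¹ ≠ 1 := by
    intro _ h3 e
    apply h3
    have : χ r - χ r' = 1 := by rw [← inv_inv (χ r - χ r'), e, inv_one]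
    rw [← this]; ring
  unfold bkQScalar
  split_ifs with h1 h2 h3 h4
  · exact one_ne_zero
  · exact neg_ne_zero.2 (bkPScalar_ne_zero k r r' χ)
  · rw [hp h1, show (χ r - χ r')⁻¹ * (χ r - χ r')⁻¹ - (χ r - χ r')⁻¹ = (χ r - χ r')⁻¹ * ((χ r - χ r')⁻¹ - 1) by ring]
    exact mul_ne_zero (inv_ne_zero (sub_ne_zero.2 h1)) (sub_ne_zero.2 (key h1 h3))
  · exact one_ne_zero
  · rw [hp h1]
    exact sub_ne_zero.2 (Ne.symm (key h1 h4))

/-- **`x p_r(𝐢) ≡ bkPScalar · c · m_{𝔰𝔱}` if `x ≡ c · m_{𝔰𝔱}`.** [folklore] -/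
theorem PairCong.mul_bkP {s t : StdFilling n μ.youngDiagram} {x : MonoidAlgebra k (Perm (Fin n))} {c : k}
    (hx : PairCong k s t x c) (r r' : Fin n) (χ : Fin n → k) :
    PairCong k s t (x * bkP k r r' χ) (c * bkPScalar k r r' χ) := by
  unfold bkP bkPScalar
  split_ifs with h
  · rwa [mul_one, mul_one]
  · have hc : χ r - χ r' ≠ 0 := sub_ne_zero.2 h
    exact hx.mul_ringInverse (isUnit_bkDiffUnit k r r' hc) (fun y hy => mul_bkDiffUnit_mem_pairUpper hy r r' _) hc
      (by simpa only [one_mul] using (pairCong_murphy s t).mul_bkDiffUnit r r' (χ r - χ r'))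

/-- `V(𝔰,𝔱) p_r(𝐢) ⊆ V(𝔰,𝔱)`. [folklore] -/
theorem mul_bkP_mem_pairUpper {s t : StdFilling n μ.youngDiagram} {x : MonoidAlgebra k (Perm (Fin n))}
    (hx : x ∈ pairUpper k s t) (r r' : Fin n) (χ : Fin n → k) : x * bkP k r r' χ ∈ pairUpper k s t := by
  have := (pairCong_zero_iff.2 hx).mul_bkP r r' χ
  rwa [zero_mul, pairCong_zero_iff] at this

/-- **`x q_r(𝐢) ≡ bkQScalar · c · m_{𝔰𝔱}` if `x ≡ c · m_{𝔰𝔱}`.** [folklore] -/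
theorem PairCong.mul_bkQ {s t : StdFilling n μ.youngDiagram} {x : MonoidAlgebra k (Perm (Fin n))} {c : k}
    (hx : PairCong k s t x c) (r r' : Fin n) (χ : Fin n → k) :
    PairCong k s t (x * bkQ k r r' χ) (c * bkQScalar k r r' χ) := by
  have hP := hx.mul_bkP r r' χ
  have hPP := hP.mul_bkP r r' χ
  unfold bkQ bkQScalar
  split_ifs with h1 h2 h3 h4
  · rw [mul_add, mul_one, mul_sub, mul_one]
    exact hx.add_mem (Submodule.sub_mem _ (hx.mul_bkNilpotent r') (hx.mul_bkNilpotent r))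
  · rw [mul_neg, mul_neg]; exact hP.neg
  · rw [mul_sub, mul_sub, ← mul_assoc, ← mul_assoc]; exact hPP.sub hP
  · rwa [mul_one, mul_one]
  · rw [mul_sub, mul_one, mul_sub, mul_one]; exact hx.sub hP

/-- `V(𝔰,𝔱) q_r(𝐢) ⊆ V(𝔰,𝔱)`. [folklore] -/
theorem mul_bkQ_mem_pairUpper {s t : StdFilling n μ.youngDiagram} {x : MonoidAlgebra k (Perm (Fin n))}
    (hx : x ∈ pairUpper k s t) (r r' : Fin n) (χ : Fin n → k) : x * bkQ k r r' χ ∈ pairUpper k s t := by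
  have := (pairCong_zero_iff.2 hx).mul_bkQ r r' χ
  rwa [zero_mul, pairCong_zero_iff] at this

/-- **`x q_r(𝐢)⁻¹ ≡ bkQScalar⁻¹ · c · m_{𝔰𝔱}` if `x ≡ c · m_{𝔰𝔱}`.** [folklore] -/
theorem PairCong.mul_ringInverse_bkQ {s t : StdFilling n μ.youngDiagram} {x : MonoidAlgebra k (Perm (Fin n))} {c : k}
    (hx : PairCong k s t x c) (r r' : Fin n) (χ : Fin n → k) :
    PairCong k s t (x * Ring.inverse (bkQ k r r' χ)) (c * (bkQScalar k r r' χ)⁻¹) :=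
  hx.mul_ringInverse (isUnit_bkQ k r r' χ) (fun y hy => mul_bkQ_mem_pairUpper hy r r' χ) (bkQScalar_ne_zero k r r' χ)
    (by simpa only [one_mul] using (pairCong_murphy s t).mul_bkQ r r' χ)

/-- `V(𝔰,𝔱) q_r(𝐢)⁻¹ ⊆ V(𝔰,𝔱)`. [folklore] -/
theorem mul_ringInverse_bkQ_mem_pairUpper {s t : StdFilling n μ.youngDiagram} {x : MonoidAlgebra k (Perm (Fin n))}
    (hx : x ∈ pairUpper k s t) (r r' : Fin n) (χ : Fin n → k) : x * Ring.inverse (bkQ k r r' χ) ∈ pairUpper k s t := by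
  have := (pairCong_zero_iff.2 hx).mul_ringInverse_bkQ r r' χ
  rwa [zero_mul, pairCong_zero_iff] at this

/-! #### `*` on `p_r`, `q_r` and the left versions -/

variable (k) in
/-- `(a + y_r - y_{r'})* = a + y_r - y_{r'}`. [folklore] -/
theorem grpAlgStar_bkDiffUnit (r r' : Fin n) (a : k) : grpAlgStar k (bkDiffUnit k r r' a) = bkDiffUnit k r r' a := by
  rw [bkDiffUnit, map_add, map_sub, grpAlgStar_bkNilpotent, grpAlgStar_bkNilpotent, Algebra.algebraMap_eq_smul_one, map_smul,
    grpAlgStar_one]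

variable (k) in
/-- `p_r(𝐢)* = p_r(𝐢)`. [folklore] -/
theorem grpAlgStar_bkP (r r' : Fin n) (χ : Fin n → k) : grpAlgStar k (bkP k r r' χ) = bkP k r r' χ := by
  unfold bkP
  split_ifs with h
  · exact grpAlgStar_one k
  · rw [grpAlgStar_ringInverse k (isUnit_bkDiffUnit k r r' (sub_ne_zero.2 h)), grpAlgStar_bkDiffUnit]

variable (k) in
/-- `q_r(𝐢)* = q_r(𝐢)`. [folklore] -/
theorem grpAlgStar_bkQ (r r' : Fin n) (χ : Fin n → k) : grpAlgStar k (bkQ k r r' χ) = bkQ k r r' χ := by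
  unfold bkQ
  split_ifs <;> simp only [map_add, map_sub, map_neg, grpAlgStar_mul, grpAlgStar_bkP, grpAlgStar_bkNilpotent, grpAlgStar_one]

variable (k) in
/-- `(q_r(𝐢)⁻¹)* = q_r(𝐢)⁻¹`. [folklore] -/
theorem grpAlgStar_ringInverse_bkQ (r r' : Fin n) (χ : Fin n → k) :
    grpAlgStar k (Ring.inverse (bkQ k r r' χ)) = Ring.inverse (bkQ k r r' χ) := by
  rw [grpAlgStar_ringInverse k (isUnit_bkQ k r r' χ), grpAlgStar_bkQ]

/-- `p_r(𝐢) x ≡ bkPScalar · c · m_{𝔰𝔱}` (by `*`). [folklore] -/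
theorem PairCong.bkP_mul {s t : StdFilling n μ.youngDiagram} {x : MonoidAlgebra k (Perm (Fin n))} {c : k}
    (hx : PairCong k s t x c) (r r' : Fin n) (χ : Fin n → k) :
    PairCong k s t (bkP k r r' χ * x) (c * bkPScalar k r r' χ) := by
  have := (hx.star.mul_bkP r r' χ).star
  rwa [grpAlgStar_mul, grpAlgStar_bkP, grpAlgStar_grpAlgStar] at this

/-- `q_r(𝐢)⁻¹ x ≡ bkQScalar⁻¹ · c · m_{𝔰𝔱}` (by `*`). [folklore] -/
theorem PairCong.ringInverse_bkQ_mul {s t : StdFilling n μ.youngDiagram} {x : MonoidAlgebra k (Perm (Fin n))} {c : k}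
    (hx : PairCong k s t x c) (r r' : Fin n) (χ : Fin n → k) :
    PairCong k s t (Ring.inverse (bkQ k r r' χ) * x) (c * (bkQScalar k r r' χ)⁻¹) := by
  have := (hx.star.mul_ringInverse_bkQ r r' χ).star
  rwa [grpAlgStar_mul, grpAlgStar_ringInverse_bkQ, grpAlgStar_grpAlgStar] at this

/-- `q_r(𝐢)⁻¹ x ∈ V(𝔰,𝔱)` for `x ∈ V(𝔰,𝔱)`. [folklore] -/
theorem ringInverse_bkQ_mul_mem_pairUpper {s t : StdFilling n μ.youngDiagram} {x : MonoidAlgebra k (Perm (Fin n))}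
    (hx : x ∈ pairUpper k s t) (r r' : Fin n) (χ : Fin n → k) : Ring.inverse (bkQ k r r' χ) * x ∈ pairUpper k s t := by
  have := (pairCong_zero_iff.2 hx).ringInverse_bkQ_mul r r' χ
  rwa [zero_mul, pairCong_zero_iff] at this

/-! #### `ψ_r` along an admissible step -/

omit [DecidableEq k] in
/-- `V(𝔰,𝔳) Φ_r ⊆ V(𝔰,𝔳')` for the intertwiner `Φ_r = s_r (L_r - L_{r+1}) + 1`. [folklore] -/
theorem mul_bkIntertwiner_mem_pairUpper {s v v' : StdFilling n μ.youngDiagram} {x : MonoidAlgebra k (Perm (Fin n))}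
    (hx : x ∈ pairUpper k s v) {r r' : Fin n} (h : (r' : ℕ) = r + 1) (hv' : v'.1 = v.1 ∘ ⇑(swap r r'))
    (hrow : (v.1 r).1 < (v.1 r').1) : x * bkIntertwiner k r r' ∈ pairUpper k s v' := by
  rw [bkIntertwiner, mul_add, mul_one, ← mul_assoc, mul_sub]
  have h1 := mul_of_swap_mem_pairUpper hx h hv' hrow
  exact Submodule.add_mem _ (Submodule.sub_mem _ (mul_jucysMurphy_mem_pairUpper r h1) (mul_jucysMurphy_mem_pairUpper r' h1))
    (pairUpper_le_right k s (stdSDom_of_comp_swap h hv' hrow) hx)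

/-- **`V(𝔰,𝔳) φ_r ⊆ V(𝔰,𝔳')`** along an admissible step `𝔳 → 𝔳'`. [folklore] -/
theorem mul_bkPhi_mem_pairUpper {s v v' : StdFilling n μ.youngDiagram} {x : MonoidAlgebra k (Perm (Fin n))}
    (hx : x ∈ pairUpper k s v) {r r' : Fin n} (h : (r' : ℕ) = r + 1) (hv' : v'.1 = v.1 ∘ ⇑(swap r r'))
    (hrow : (v.1 r).1 < (v.1 r').1) : x * bkPhi k r r' ∈ pairUpper k s v' := by
  rw [bkPhi, Finset.mul_sum]
  refine Submodule.sum_mem _ fun χ _ => ?_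
  have hle := pairUpper_le_right k s (stdSDom_of_comp_swap h hv' hrow)
  split_ifs with hc
  · rw [← mul_assoc, mul_add, mul_one]
    exact mul_klrIdempotent_mem_pairUpper (Submodule.add_mem _ (mul_of_swap_mem_pairUpper hx h hv' hrow) (hle hx)) χ
  · rw [← mul_assoc, ← mul_assoc]
    exact mul_klrIdempotent_mem_pairUpper (mul_ringInverse_mem_of_isUnit (isUnit_bkDiffUnit k r r' (sub_ne_zero.2 hc))
      (fun y hy => mul_bkDiffUnit_mem_pairUpper hy r r' _) (mul_bkIntertwiner_mem_pairUpper hx h hv' hrow)) χ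

/-- **`V(𝔰,𝔳) ψ_r ⊆ V(𝔰,𝔳')`** along an admissible step `𝔳 → 𝔳'`. [folklore] -/
theorem mul_bkPsi_mem_pairUpper {s v v' : StdFilling n μ.youngDiagram} {x : MonoidAlgebra k (Perm (Fin n))}
    (hx : x ∈ pairUpper k s v) {r r' : Fin n} (h : (r' : ℕ) = r + 1) (hv' : v'.1 = v.1 ∘ ⇑(swap r r'))
    (hrow : (v.1 r).1 < (v.1 r').1) : x * bkPsi k r r' ∈ pairUpper k s v' := by
  rw [bkPsi, Finset.mul_sum]
  refine Submodule.sum_mem _ fun χ _ => ?_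
  rw [← mul_assoc, ← mul_assoc]
  exact mul_klrIdempotent_mem_pairUpper (mul_ringInverse_bkQ_mem_pairUpper (mul_bkPhi_mem_pairUpper hx h hv' hrow) r r' χ) χ

omit [DecidableEq k] in
/-- The content sequence of `𝔳 ∘ s_r` is that of `𝔳` composed with `s_r`. [folklore] -/
theorem contSeq_of_comp_swap {v v' : StdFilling n μ.youngDiagram} {r r' : Fin n} (hv' : v'.1 = v.1 ∘ ⇑(swap r r')) :
    contSeq k v' = contSeq k v ∘ ⇑(swap r r') := by
  funext i; simp only [contSeq, jmContent, hv', Function.comp_apply]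

/-- **The right `ψ`-step (Hu–Mathas 2010, proof of Lemma 46, at level one)**: if
`x ≡ c · m_{𝔰𝔳} (mod V(𝔰,𝔳))` and `𝔳 → 𝔳' = 𝔳 ∘ s_r` is an admissible step (`r` strictly above
`r+1` in `𝔳`), then `x ψ_r ≡ c q⁻¹ · m_{𝔰𝔳'} (mod V(𝔰,𝔳'))` with the nonzero scalar
`q = bkQScalar (𝐢^{𝔳'})`: `x ψ_r = x e(𝐢^𝔳) ψ_r + (error) = x e(𝐢^𝔳) (s_r + p_r) e(𝐢^{𝔳'}) q_r⁻¹ + (error)`.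
[cite: HuMathas2010, Lemma 46] -/
theorem PairCong.mul_bkPsi {s v v' : StdFilling n μ.youngDiagram} {x : MonoidAlgebra k (Perm (Fin n))} {c : k}
    (hx : PairCong k s v x c) {r r' : Fin n} (h : (r' : ℕ) = r + 1) (hv' : v'.1 = v.1 ∘ ⇑(swap r r'))
    (hrow : (v.1 r).1 < (v.1 r').1) :
    PairCong k s v' (x * bkPsi k r r') (c * (bkQScalar k r r' (contSeq k v'))⁻¹) := by
  have hsplit : x = ∑ χ ∈ residueSeqs k n, x * klrIdempotent k χ := by
    rw [← Finset.mul_sum, sum_residueSeqs_klrIdempotent, mul_one]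
  set x₁ := x * klrIdempotent k (contSeq k v) with hx₁def
  have hx₁ : PairCong k s v x₁ c := hx.mul_klrIdempotent_self
  -- the main term
  have hback : contSeq k v' ∘ ⇑(swap r r') = contSeq k v := by
    rw [contSeq_of_comp_swap hv']; funext i; simp only [Function.comp_apply, swap_apply_self]
  have hcomm : Commute (klrIdempotent k (contSeq k v')) (Ring.inverse (bkQ k r r' (contSeq k v'))) :=
    commute_ringInverse_bkQ k (commute_klrIdempotent_bkNilpotent k _) r r' _
  have e1 : x₁ * bkPsi k r r' =
      (x₁ * MonoidAlgebra.of k _ (swap r r') + x₁ * bkP k r r' (contSeq k v')) * klrIdempotent k (contSeq k v') *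
        Ring.inverse (bkQ k r r' (contSeq k v')) := by
    have hee : x₁ = x₁ * klrIdempotent k (contSeq k v) := by rw [hx₁def, mul_assoc, klrIdempotent_mul_self]
    conv_lhs => rw [hee, mul_assoc, ← hback, ← bkPsi_mul_klrIdempotent_eq k h, bkPsi_mul_klrIdempotent,
      mul_assoc (bkPhi k r r'), ← hcomm.eq, ← mul_assoc (bkPhi k r r'), bkPhi_mul_klrIdempotent_eq_swap_add_bkP]
    simp only [mul_add, add_mul, mul_assoc]
  have hmain : PairCong k s v' (x₁ * bkPsi k r r') (c * (bkQScalar k r r' (contSeq k v'))⁻¹) := by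
    rw [e1]
    have h2 : PairCong k s v' (x₁ * MonoidAlgebra.of k _ (swap r r') + x₁ * bkP k r r' (contSeq k v')) c :=
      (hx₁.mul_of_swap h hv' hrow).add_mem ((hx₁.mul_bkP r r' _).mem_of_sdom_right (stdSDom_of_comp_swap h hv' hrow))
    exact h2.mul_klrIdempotent_self.mul_ringInverse_bkQ r r' _
  -- the other idempotent components are error terms
  rw [PairCong, hsplit, Finset.sum_mul, ← Finset.add_sum_erase _ _ (contSeq_mem_residueSeqs k v), add_sub_right_comm]
  refine Submodule.add_mem _ hmain (Submodule.sum_mem _ fun χ hχ => ?_)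
  exact mul_bkPsi_mem_pairUpper (hx.mul_klrIdempotent_of_ne (Finset.mem_erase.1 hχ).1) h hv' hrow

/-- **The left `ψ`-step**: if `x ≡ c · m_{𝔲𝔱} (mod V(𝔲,𝔱))` and `𝔲 → 𝔲' = 𝔲 ∘ s_r` is an admissible
step, then `ψ_r x ≡ c q⁻¹ · m_{𝔲'𝔱} (mod V(𝔲',𝔱))` with `q = bkQScalar (𝐢^𝔲) ≠ 0`:
`ψ_r e(𝐢^𝔲) x = (s_r + p_r(𝐢^𝔲)) e(𝐢^𝔲) q_r(𝐢^𝔲)⁻¹ x`. [cite: HuMathas2010, Lemma 46] -/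
theorem PairCong.bkPsi_mul {u u' t : StdFilling n μ.youngDiagram} {x : MonoidAlgebra k (Perm (Fin n))} {c : k}
    (hx : PairCong k u t x c) {r r' : Fin n} (h : (r' : ℕ) = r + 1) (hu' : u'.1 = u.1 ∘ ⇑(swap r r'))
    (hrow : (u.1 r).1 < (u.1 r').1) :
    PairCong k u' t (bkPsi k r r' * x) (c * (bkQScalar k r r' (contSeq k u))⁻¹) := by
  have hsplit : x = ∑ χ ∈ residueSeqs k n, klrIdempotent k χ * x := by
    rw [← Finset.sum_mul, sum_residueSeqs_klrIdempotent, one_mul]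
  have hsdom := stdSDom_of_comp_swap h hu' hrow
  -- `ψ_r e(𝐣) z = (s_r + p_r(𝐣)) e(𝐣) q_r(𝐣)⁻¹ e(𝐣) z`
  have hexp : ∀ (χ : Fin n → k) (z : MonoidAlgebra k (Perm (Fin n))),
      bkPsi k r r' * (klrIdempotent k χ * z) =
        (MonoidAlgebra.of k _ (swap r r') + bkP k r r' χ) * (klrIdempotent k χ * (Ring.inverse (bkQ k r r' χ) *
          (klrIdempotent k χ * z))) := by
    intro χ z
    have hcomm : Commute (klrIdempotent k χ) (Ring.inverse (bkQ k r r' χ)) :=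
      commute_ringInverse_bkQ k (commute_klrIdempotent_bkNilpotent k _) r r' _
    conv_lhs => rw [← klrIdempotent_mul_self, mul_assoc (klrIdempotent k χ), ← mul_assoc, bkPsi_mul_klrIdempotent,
      mul_assoc (bkPhi k r r'), ← hcomm.eq, ← mul_assoc (bkPhi k r r'), bkPhi_mul_klrIdempotent_eq_swap_add_bkP]
    simp only [mul_assoc]
  -- error terms: `ψ_r e(𝐣) V(𝔲,𝔱) ⊆ V(𝔲',𝔱)`
  have herr : ∀ (χ : Fin n → k) (z : MonoidAlgebra k (Perm (Fin n))), z ∈ pairUpper k u t →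
      bkPsi k r r' * (klrIdempotent k χ * z) ∈ pairUpper k u' t := by
    intro χ z hz
    rw [hexp, add_mul]
    have hw : klrIdempotent k χ * (Ring.inverse (bkQ k r r' χ) * (klrIdempotent k χ * z)) ∈ pairUpper k u t :=
      klrIdempotent_mul_mem_pairUpper (ringInverse_bkQ_mul_mem_pairUpper (klrIdempotent_mul_mem_pairUpper hz χ) r r' χ) χ
    refine Submodule.add_mem _ (of_swap_mul_mem_pairUpper h hu' hrow hw) (pairUpper_le_left k t hsdom ?_)
    have := grpAlgStar_mem_pairUpper k (mul_bkP_mem_pairUpper (grpAlgStar_mem_pairUpper k hw) r r' χ)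
    rwa [grpAlgStar_mul, grpAlgStar_bkP, grpAlgStar_grpAlgStar] at this
  -- the main term
  have hmain : PairCong k u' t (bkPsi k r r' * (klrIdempotent k (contSeq k u) * x)) (c * (bkQScalar k r r' (contSeq k u))⁻¹) := by
    rw [hexp, add_mul]
    have hw : PairCong k u t (klrIdempotent k (contSeq k u) * (Ring.inverse (bkQ k r r' (contSeq k u)) *
        (klrIdempotent k (contSeq k u) * x))) (c * (bkQScalar k r r' (contSeq k u))⁻¹) :=
      (hx.klrIdempotent_self_mul.ringInverse_bkQ_mul r r' _).klrIdempotent_self_mul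
    exact (hw.of_swap_mul h hu' hrow).add_mem ((hw.bkP_mul r r' _).mem_of_sdom_left hsdom)
  rw [PairCong, hsplit, Finset.mul_sum, ← Finset.add_sum_erase _ _ (contSeq_mem_residueSeqs k u), add_sub_right_comm]
  refine Submodule.add_mem _ hmain (Submodule.sum_mem _ fun χ hχ => ?_)
  rw [show klrIdempotent k χ * x = klrIdempotent k χ * (klrIdempotent k χ * x) by rw [← mul_assoc, klrIdempotent_mul_self]]
  exact herr χ _ (hx.klrIdempotent_mul_of_ne (Finset.mem_erase.1 hχ).1)

end FieldCalc

/-! ### `e_λ y_λ ≡ c_λ x_λ`: the leading term of `ψ_{𝔱^λ𝔱^λ}` (Hu–Mathas' Cor. 42 at level one) -/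

section YLambda

variable (k : Type*) [Field k] [DecidableEq k] {n : ℕ} (μ : Nat.Partition n)

omit [DecidableEq k] in
/-- `c_m = col_m + 1 ∈ k`, `col_m` the column of the entry `m` of `𝔱^λ`. [folklore] -/
def colSucc (m : Fin n) : k := (μ.colOf m : k) + 1

/-- **`e_λ = e(𝐢^λ)`**, `𝐢^λ` the residue (content) sequence of `𝔱^λ`. [cite: HuMathas2010, §4.3 Def. 41] -/
def eLam : MonoidAlgebra k (Perm (Fin n)) := klrIdempotent k (contSeq k (rowReading μ))

/-- The factor of `y_λ` at the entry `m` of `𝔱^λ`: `y_m` if `p ∣ col_m + 1` (the addable node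
`(row_m + 1, 0)` below `m` has the residue of `m`), else `1`. [cite: HuMathas2010, Def. 36, Def. 41] -/
def yLamFactor (m : Fin n) : MonoidAlgebra k (Perm (Fin n)) := if colSucc k μ m = 0 then bkNilpotent k m else 1

/-- The unit factor at the entry `m`: `1` if `p ∣ col_m + 1`, else `c_m + y_m`. [folklore] -/
def wLamFactor (m : Fin n) : MonoidAlgebra k (Perm (Fin n)) :=
  if colSucc k μ m = 0 then 1 else algebraMap k _ (colSucc k μ m) + bkNilpotent k m

/-- The scalar factor at the entry `m`: `1` if `p ∣ col_m + 1`, else `c_m⁻¹`. [folklore] -/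
def cLamFactor (m : Fin n) : k := if colSucc k μ m = 0 then 1 else (colSucc k μ m)⁻¹

/-- `∏_{m' < m} yLamFactor m'`. [folklore] -/
def yLamProd : ℕ → MonoidAlgebra k (Perm (Fin n))
  | 0 => 1
  | m + 1 => yLamProd m * if h : m < n then yLamFactor k μ ⟨m, h⟩ else 1

/-- `∏_{m' < m} wLamFactor m'`. [folklore] -/
def wLamProd : ℕ → MonoidAlgebra k (Perm (Fin n))
  | 0 => 1
  | m + 1 => wLamProd m * if h : m < n then wLamFactor k μ ⟨m, h⟩ else 1

/-- `∏_{m' < m} cLamFactor m'`. [folklore] -/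
def cLamProd : ℕ → k
  | 0 => 1
  | m + 1 => cLamProd m * if h : m < n then cLamFactor k μ ⟨m, h⟩ else 1

/-- **`y_λ = ∏_{m : p ∣ col_m + 1} y_m`** (Hu–Mathas' `y_λ = y_{𝔱^λ} = ∏_m y_m^{|𝒜_{𝔱^λ}(m)|}` at level
one: for `𝔱^λ` the only addable node strictly below the entry `m` is `(row_m + 1, 0)`, of residue
`-(row_m + 1)`, which is the residue `col_m - row_m` of `m` iff `p ∣ col_m + 1`).
[cite: HuMathas2010, Def. 36, Lemma 37, Def. 41] -/
def yLam : MonoidAlgebra k (Perm (Fin n)) := yLamProd k μ n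

/-- **`c_λ = ∏_{m : p ∤ col_m + 1} (col_m + 1)⁻¹ ≠ 0`**, the leading coefficient of `e_λ y_λ`.
[cite: HuMathas2010, Cor. 42] -/
def cLam : k := cLamProd k μ n

variable {μ}

/-! #### Commutation -/

/-- The factors of `y_λ` commute with the `y_t`. [folklore] -/
theorem commute_yLamFactor_bkNilpotent (m t : Fin n) : Commute (yLamFactor k μ m) (bkNilpotent k t) := by
  unfold yLamFactor
  split_ifs
  · exact commute_bkNilpotent k m t
  · exact Commute.one_left _

/-- The unit factors commute with the `y_t`. [folklore] -/
theorem commute_wLamFactor_bkNilpotent (m t : Fin n) : Commute (wLamFactor k μ m) (bkNilpotent k t) := by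
  unfold wLamFactor
  split_ifs
  · exact Commute.one_left _
  · exact (Algebra.commute_algebraMap_left _ _).add_left (commute_bkNilpotent k m t)

/-- `yLamProd m` commutes with the `y_t`. [folklore] -/
theorem commute_yLamProd_bkNilpotent (m : ℕ) (t : Fin n) : Commute (yLamProd k μ m) (bkNilpotent k t) := by
  induction m with
  | zero => exact Commute.one_left _
  | succ m ih =>
    rw [yLamProd]
    refine ih.mul_left ?_
    split_ifs
    · exact commute_yLamFactor_bkNilpotent k _ t
    · exact Commute.one_left _

/-- `wLamProd m` commutes with the `y_t`. [folklore] -/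
theorem commute_wLamProd_bkNilpotent (m : ℕ) (t : Fin n) : Commute (wLamProd k μ m) (bkNilpotent k t) := by
  induction m with
  | zero => exact Commute.one_left _
  | succ m ih =>
    rw [wLamProd]
    refine ih.mul_left ?_
    split_ifs
    · exact commute_wLamFactor_bkNilpotent k _ t
    · exact Commute.one_left _

/-- The unit factors commute with `yLamProd`. [folklore] -/
theorem commute_wLamFactor_yLamProd (m' : Fin n) (m : ℕ) : Commute (wLamFactor k μ m') (yLamProd k μ m) := by
  unfold wLamFactor
  split_ifs
  · exact Commute.one_left _
  · exact (Algebra.commute_algebraMap_left _ _).add_left (commute_yLamProd_bkNilpotent k m m').symm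

/-- `e_λ` commutes with the `y_t`. [folklore] -/
theorem commute_eLam_bkNilpotent (t : Fin n) : Commute (eLam k μ) (bkNilpotent k t) :=
  commute_klrIdempotent_bkNilpotent k _ t

/-- `e_λ` commutes with `yLamProd`. [folklore] -/
theorem commute_eLam_yLamProd (m : ℕ) : Commute (eLam k μ) (yLamProd k μ m) := by
  induction m with
  | zero => exact Commute.one_right _
  | succ m ih =>
    rw [yLamProd]
    refine ih.mul_right ?_
    split_ifs
    · unfold yLamFactor
      split_ifs
      · exact commute_eLam_bkNilpotent k _
      · exact Commute.one_right _
    · exact Commute.one_right _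

/-- `e_λ y_λ = y_λ e_λ`. [folklore] -/
theorem eLam_mul_yLam : eLam k μ * yLam k μ = yLam k μ * eLam k μ := (commute_eLam_yLamProd k n).eq

/-! #### The factorwise identity `(L_m + row_m + 1) e_λ = (c_m + y_m) e_λ` -/

/-- **`(L_m + r_m + 1) e_λ = w_m y'_m e_λ`**: on `e(𝐢^λ)`, `L_m = i_m + y_m` with
`i_m = col_m - row_m`, so `L_m + row_m + 1 = (col_m + 1) + y_m`.
[cite: HuMathas2010, §3.2 (definition of y_r, before Thm 24)] -/
theorem jmFactor_mul_eLam (m : Fin n) :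
    (jucysMurphy k m + ((μ.rowOf m + 1 : ℕ) : MonoidAlgebra k (Perm (Fin n)))) * eLam k μ =
      wLamFactor k μ m * yLamFactor k μ m * eLam k μ := by
  have hL : jucysMurphy k m * eLam k μ = bkNilpotent k m * eLam k μ + contSeq k (rowReading μ) m • eLam k μ := by
    rw [eLam, bkNilpotent_mul_klrIdempotent, sub_add_cancel]
  have hc : contSeq k (rowReading μ) m + ((μ.rowOf m + 1 : ℕ) : k) = colSucc k μ m := by
    simp only [contSeq, jmContent, rowReading_apply, colSucc]
    push_cast
    ring
  have hcast : ((μ.rowOf m + 1 : ℕ) : MonoidAlgebra k (Perm (Fin n))) * eLam k μ = ((μ.rowOf m + 1 : ℕ) : k) • eLam k μ := by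
    rw [← map_natCast (algebraMap k (MonoidAlgebra k (Perm (Fin n)))), ← Algebra.smul_def]
  rw [add_mul, hL, hcast, add_assoc, ← add_smul, hc]
  unfold wLamFactor yLamFactor
  split_ifs with h0
  · rw [h0, zero_smul, add_zero, one_mul]
  · rw [mul_one, add_mul, ← Algebra.smul_def, add_comm]

omit [DecidableEq k] in
/-- The Jucys–Murphy elements and the scalars commute with `e_λ`. [folklore] -/
theorem jmFactor_mul_eLam_comm (m : Fin n) :
    (jucysMurphy k m + ((μ.rowOf m + 1 : ℕ) : MonoidAlgebra k (Perm (Fin n)))) * eLam k μ =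
      eLam k μ * (jucysMurphy k m + ((μ.rowOf m + 1 : ℕ) : MonoidAlgebra k (Perm (Fin n)))) := by
  rw [add_mul, mul_add, eLam, jucysMurphy_mul_klrIdempotent, Nat.cast_comm]

/-- **`(∏_{m} (L_m + r_m + 1)) e_λ = (∏ w_m) (∏ y'_m) e_λ`.** [folklore] -/
theorem jmProd_mul_eLam : ∀ m : ℕ, jmProd k μ m * eLam k μ = wLamProd k μ m * yLamProd k μ m * eLam k μ
  | 0 => by simp only [jmProd_zero, wLamProd, yLamProd, one_mul]
  | m + 1 => by
    by_cases hm : m < n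
    · set i : Fin n := ⟨m, hm⟩
      have e1 : jmProd k μ (m + 1) = jmProd k μ m * (jucysMurphy k i + ((μ.rowOf i + 1 : ℕ) : MonoidAlgebra k (Perm (Fin n)))) := by
        rw [jmProd, dif_pos hm]
      have e2 : wLamProd k μ (m + 1) = wLamProd k μ m * wLamFactor k μ i := by rw [wLamProd, dif_pos hm]
      have e3 : yLamProd k μ (m + 1) = yLamProd k μ m * yLamFactor k μ i := by rw [yLamProd, dif_pos hm]
      rw [e1, e2, e3, mul_assoc, jmFactor_mul_eLam_comm, ← mul_assoc, jmProd_mul_eLam m,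
        mul_assoc (wLamProd k μ m * yLamProd k μ m), ← jmFactor_mul_eLam_comm, jmFactor_mul_eLam]
      simp only [← mul_assoc]
      rw [mul_assoc (wLamProd k μ m) (yLamProd k μ m) (wLamFactor k μ i), ← (commute_wLamFactor_yLamProd k i m).eq,
        ← mul_assoc]
    · have e1 : jmProd k μ (m + 1) = jmProd k μ m := by rw [jmProd, dif_neg hm, mul_one]
      have e2 : wLamProd k μ (m + 1) = wLamProd k μ m := by rw [wLamProd, dif_neg hm, mul_one]
      have e3 : yLamProd k μ (m + 1) = yLamProd k μ m := by rw [yLamProd, dif_neg hm, mul_one]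
      rw [e1, e2, e3, jmProd_mul_eLam m]

/-! #### Units and leading terms -/

/-- The unit factors are units (a nonzero scalar plus a nilpotent). [folklore] -/
theorem isUnit_wLamFactor (m : Fin n) : IsUnit (wLamFactor k μ m) := by
  unfold wLamFactor
  split_ifs with h0
  · exact isUnit_one
  · exact (show IsNilpotent (bkNilpotent k m) from ⟨_, bkNilpotent_pow_factorial k m⟩).isUnit_add_left_of_commute
      ((IsUnit.mk0 _ h0).map (algebraMap k _)) (Algebra.commute_algebraMap_right _ _)

/-- `(w_m)* = w_m`. [folklore] -/
theorem grpAlgStar_wLamFactor (m : Fin n) : grpAlgStar k (wLamFactor k μ m) = wLamFactor k μ m := by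
  unfold wLamFactor
  split_ifs
  · exact grpAlgStar_one k
  · rw [map_add, grpAlgStar_bkNilpotent, Algebra.algebraMap_eq_smul_one, map_smul, grpAlgStar_one]

variable {k} in
/-- **`x w_m ≡ (col_m + 1 or 1) c · m_{𝔰𝔱}` if `x ≡ c · m_{𝔰𝔱}`.** [folklore] -/
theorem PairCong.mul_wLamFactor {ν : Nat.Partition n} {s t : StdFilling n ν.youngDiagram} {x : MonoidAlgebra k (Perm (Fin n))}
    {c : k} (hx : PairCong k s t x c) (m : Fin n) :
    PairCong k s t (x * wLamFactor k μ m) (c * if colSucc k μ m = 0 then 1 else colSucc k μ m) := by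
  unfold wLamFactor
  split_ifs with h0
  · rwa [mul_one, mul_one]
  · rw [mul_add, ← Algebra.commutes, ← Algebra.smul_def]
    have h1 : PairCong k s t (colSucc k μ m • x) (c * colSucc k μ m) := by rw [mul_comm]; exact hx.smul _
    exact h1.add_mem (hx.mul_bkNilpotent m)

variable {k} in
/-- **`w_m⁻¹ x ≡ cLamFactor · c · m_{𝔰𝔱}` if `x ≡ c · m_{𝔰𝔱}`** (by `*` and the division lemma). [folklore] -/
theorem PairCong.ringInverse_wLamFactor_mul {ν : Nat.Partition n} {s t : StdFilling n ν.youngDiagram}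
    {x : MonoidAlgebra k (Perm (Fin n))} {c : k} (hx : PairCong k s t x c) (m : Fin n) :
    PairCong k s t (Ring.inverse (wLamFactor k μ m) * x) (c * cLamFactor k μ m) := by
  have hd : (if colSucc k μ m = 0 then (1 : k) else colSucc k μ m) ≠ 0 := by
    split_ifs with h0
    · exact one_ne_zero
    · exact h0
  have hm : PairCong k t s (murphy k t s * wLamFactor k μ m) (if colSucc k μ m = 0 then (1 : k) else colSucc k μ m) := by
    have := (pairCong_murphy (R := k) t s).mul_wLamFactor (μ := μ) m
    rw [one_mul] at this
    exact this
  have hN : ∀ y ∈ pairUpper k t s, y * wLamFactor k μ m ∈ pairUpper k t s := fun y hy => by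
    have := (pairCong_zero_iff.2 hy).mul_wLamFactor (μ := μ) m
    rw [zero_mul, pairCong_zero_iff] at this
    exact this
  have h1 := hx.star.mul_ringInverse (isUnit_wLamFactor k m) hN hd hm
  have h2 := h1.star
  rw [grpAlgStar_mul, grpAlgStar_ringInverse k (isUnit_wLamFactor k m), grpAlgStar_wLamFactor, grpAlgStar_grpAlgStar] at h2
  have hc : c * (if colSucc k μ m = 0 then (1 : k) else colSucc k μ m)⁻¹ = c * cLamFactor k μ m := by
    unfold cLamFactor
    split_ifs
    · rw [inv_one]
    · rfl
  rw [hc] at h2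
  exact h2

variable {k} in
/-- **Peeling the units**: if `W_m z ≡ c · m_{𝔰𝔱}` then `z ≡ (∏_{m'<m} cLamFactor m') c · m_{𝔰𝔱}`. [folklore] -/
theorem PairCong.of_wLamProd_mul {ν : Nat.Partition n} {s t : StdFilling n ν.youngDiagram}
    {z : MonoidAlgebra k (Perm (Fin n))} : ∀ (m : ℕ) {c : k}, PairCong k s t (wLamProd k μ m * z) c →
      PairCong k s t z (c * cLamProd k μ m)
  | 0, c, h => by rwa [wLamProd, one_mul, cLamProd, mul_one] at *
  | m + 1, c, h => by
    by_cases hm : m < n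
    · rw [wLamProd, dif_pos hm, mul_assoc] at h
      have h1 := PairCong.of_wLamProd_mul m h
      have h2 := h1.ringInverse_wLamFactor_mul (μ := μ) ⟨m, hm⟩
      rw [Ring.inverse_mul_cancel_left _ _ (isUnit_wLamFactor k _)] at h2
      rw [cLamProd, dif_pos hm, ← mul_assoc]
      exact h2
    · rw [wLamProd, dif_neg hm, mul_one] at h
      rw [cLamProd, dif_neg hm, mul_one]
      exact PairCong.of_wLamProd_mul m h

/-- `cLamFactor ≠ 0`. [folklore] -/
theorem cLamFactor_ne_zero (m : Fin n) : cLamFactor k μ m ≠ 0 := by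
  unfold cLamFactor
  split_ifs with h0
  · exact one_ne_zero
  · exact inv_ne_zero h0

/-- `cLamProd m ≠ 0`. [folklore] -/
theorem cLamProd_ne_zero : ∀ m : ℕ, cLamProd k μ m ≠ 0
  | 0 => one_ne_zero
  | m + 1 => by
    rw [cLamProd]
    refine mul_ne_zero (cLamProd_ne_zero m) ?_
    split_ifs
    · exact cLamFactor_ne_zero k _
    · exact one_ne_zero

variable (μ)

/-- **`c_λ ≠ 0`.** [cite: HuMathas2010, Cor. 42] -/
theorem cLam_ne_zero : cLam k μ ≠ 0 := cLamProd_ne_zero k n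

/-- **Hu–Mathas' Corollary 42 at level one: `y_λ e_λ ≡ c_λ x_λ (mod V(𝔱^λ,𝔱^λ))` with `c_λ ≠ 0`**
— here from the integral product formula `∏_m (L_m + r_m + 1) ≡ x_λ (mod J^{▷λ})`
(`jmProd_sub_murphyX_mem_domIdeal`) instead of seminormal forms: on `e_λ` the product is
`(∏ w_m) y_λ e_λ` with `∏ w_m` a unit acting by the nonzero scalar `c_λ⁻¹` on leading terms.
[cite: HuMathas2010, Cor. 42] -/
theorem pairCong_yLam_mul_eLam : PairCong k (rowReading μ) (rowReading μ) (yLam k μ * eLam k μ) (cLam k μ) := by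
  -- `x_λ ≡ jmProd n`, so `jmProd n e_λ ≡ 1 · x_λ`
  have h1 : PairCong k (rowReading μ) (rowReading μ) (jmProd k μ n) 1 := by
    rw [PairCong, one_smul, murphy_rowReading]
    exact domIdeal_le_pairUpper k _ _ (jmProd_sub_murphyX_mem_domIdeal k μ)
  have h2 : PairCong k (rowReading μ) (rowReading μ) (jmProd k μ n * eLam k μ) 1 := h1.mul_klrIdempotent_self
  rw [jmProd_mul_eLam, mul_assoc] at h2
  have h3 := PairCong.of_wLamProd_mul (μ := μ) n h2
  rwa [one_mul] at h3

/-- **`e_λ y_λ ≡ c_λ x_λ (mod V(𝔱^λ,𝔱^λ))`, `c_λ ≠ 0`.** [cite: HuMathas2010, Cor. 42] -/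
theorem pairCong_eLam_mul_yLam : PairCong k (rowReading μ) (rowReading μ) (eLam k μ * yLam k μ) (cLam k μ) := by
  rw [eLam_mul_yLam]; exact pairCong_yLam_mul_eLam k μ

end YLambda

/-! ### Hu–Mathas' `ψ_{𝔰𝔱}` and its leading term (Def. 43, Lemma 46 at level one) -/

section PsiElt

variable {n : ℕ} {μ : Nat.Partition n}

/-- **A fixed admissible chain `𝔱^λ = 𝔱_0 → 𝔱_1 → ⋯ → 𝔱_m = 𝔱`** (`𝔱_{j+1} = 𝔱_j ∘ s_{r_j}` with `r_j`
strictly above and right of `r_j + 1` in `𝔱_j`; `m = ℓ(d(𝔱))`): a fixed reduced expression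
`d(𝔱) = s_{r_0} ⋯ s_{r_{m-1}}` as in Hu–Mathas' Definition 43. [cite: HuMathas2010, Def. 43] -/
structure AdmChain (t : StdFilling n μ.youngDiagram) where
  /-- the length `m = ℓ(d(𝔱))` -/
  len : ℕ
  /-- the tableaux `𝔱_j` (constant beyond `m`) -/
  tab : ℕ → StdFilling n μ.youngDiagram
  /-- the positions `r_j` -/
  rs : Fin len → Fin n
  /-- the positions `r_j + 1` -/
  rs' : Fin len → Fin n
  tab_zero : tab 0 = rowReading μ
  tab_len : tab len = t
  len_eq : len = rowInv t.1
  step : ∀ j : Fin len, ((rs' j : ℕ) = rs j + 1) ∧ (tab (j + 1)).1 = (tab j).1 ∘ ⇑(swap (rs j) (rs' j)) ∧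
    ((tab j).1 (rs j)).1 < ((tab j).1 (rs' j)).1 ∧ ((tab j).1 (rs' j)).2 < ((tab j).1 (rs j)).2

/-- Admissible chains exist (`exists_admissible_chain`). [folklore] -/
theorem nonempty_admChain (t : StdFilling n μ.youngDiagram) : Nonempty (AdmChain t) := by
  obtain ⟨m, Ts, rs, rs', hTm, h0, hm, hstep⟩ := exists_admissible_chain t
  exact ⟨⟨m, Ts, rs, rs', eq_rowReading_of_rowInv_eq_zero _ h0, hTm, hm, hstep⟩⟩

/-- **The fixed chain (reduced expression) of `𝔱`.** [cite: HuMathas2010, Def. 43] -/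
def admChain (t : StdFilling n μ.youngDiagram) : AdmChain t := Classical.choice (nonempty_admChain t)

variable (k : Type*) [Field k] [DecidableEq k]

/-- `ψ_{r_0} ⋯ ψ_{r_{j-1}}`: the first `j` factors of `ψ_{d(𝔱)}`. [cite: HuMathas2010, Def. 43] -/
def psiR (t : StdFilling n μ.youngDiagram) : ℕ → MonoidAlgebra k (Perm (Fin n))
  | 0 => 1
  | j + 1 => psiR t j * if h : j < (admChain t).len then bkPsi k ((admChain t).rs ⟨j, h⟩) ((admChain t).rs' ⟨j, h⟩) else 1

/-- `ψ_{r_{j-1}} ⋯ ψ_{r_0}`: the first `j` factors of `ψ_{d(𝔰)}^*` (the graded `*` fixes the `ψ_r` and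
reverses products). [cite: HuMathas2010, Def. 43] -/
def psiL (t : StdFilling n μ.youngDiagram) : ℕ → MonoidAlgebra k (Perm (Fin n))
  | 0 => 1
  | j + 1 => (if h : j < (admChain t).len then bkPsi k ((admChain t).rs ⟨j, h⟩) ((admChain t).rs' ⟨j, h⟩) else 1) * psiL t j

/-- **Hu–Mathas' `ψ_{𝔰𝔱} = ψ_{d(𝔰)}^* e_λ y_λ ψ_{d(𝔱)}`** in `𝔽_p S_n ≅ R_n^{Λ_0}` (through Brundan–Kleshchev's
`ψ_r`, `e(𝐢)`, `y_r`). [cite: HuMathas2010, Def. 43] -/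
def psiElt (s t : StdFilling n μ.youngDiagram) : MonoidAlgebra k (Perm (Fin n)) :=
  psiL k s (admChain s).len * (eLam k μ * yLam k μ) * psiR k t (admChain t).len

/-- **The right half of Lemma 46**: `x ψ_{r_0} ⋯ ψ_{r_{j-1}} ≡ c_j · m_{𝔱^λ 𝔱_j}` with `c_j ≠ 0` whenever
`x ≡ c_0 · m_{𝔱^λ𝔱^λ}`, `c_0 ≠ 0`. [cite: HuMathas2010, Lemma 46] -/
theorem exists_pairCong_mul_psiR (t : StdFilling n μ.youngDiagram) {x : MonoidAlgebra k (Perm (Fin n))} {c₀ : k}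
    (hx : PairCong k (rowReading μ) (rowReading μ) x c₀) (hc₀ : c₀ ≠ 0) :
    ∀ j, j ≤ (admChain t).len → ∃ c : k, c ≠ 0 ∧ PairCong k (rowReading μ) ((admChain t).tab j) (x * psiR k t j) c
  | 0, _ => ⟨c₀, hc₀, by rw [psiR, mul_one, (admChain t).tab_zero]; exact hx⟩
  | j + 1, hj => by
    have hj' : j < (admChain t).len := hj
    obtain ⟨c, hc, h⟩ := exists_pairCong_mul_psiR t hx hc₀ j hj'.le
    obtain ⟨hr, hcomp, hrow, -⟩ := (admChain t).step ⟨j, hj'⟩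
    refine ⟨c * (bkQScalar k ((admChain t).rs ⟨j, hj'⟩) ((admChain t).rs' ⟨j, hj'⟩) (contSeq k ((admChain t).tab (j + 1))))⁻¹,
      mul_ne_zero hc (inv_ne_zero (bkQScalar_ne_zero k _ _ _)), ?_⟩
    rw [psiR, dif_pos hj', ← mul_assoc]
    exact h.mul_bkPsi hr hcomp hrow

/-- **The left half of Lemma 46**: `ψ_{r_{j-1}} ⋯ ψ_{r_0} x ≡ c_j · m_{𝔰_j 𝔱}` with `c_j ≠ 0` whenever
`x ≡ c_0 · m_{𝔱^λ𝔱}`, `c_0 ≠ 0`. [cite: HuMathas2010, Lemma 46] -/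
theorem exists_pairCong_psiL_mul (s : StdFilling n μ.youngDiagram) {t : StdFilling n μ.youngDiagram}
    {x : MonoidAlgebra k (Perm (Fin n))} {c₀ : k} (hx : PairCong k (rowReading μ) t x c₀) (hc₀ : c₀ ≠ 0) :
    ∀ j, j ≤ (admChain s).len → ∃ c : k, c ≠ 0 ∧ PairCong k ((admChain s).tab j) t (psiL k s j * x) c
  | 0, _ => ⟨c₀, hc₀, by rw [psiL, one_mul, (admChain s).tab_zero]; exact hx⟩
  | j + 1, hj => by
    have hj' : j < (admChain s).len := hj
    obtain ⟨c, hc, h⟩ := exists_pairCong_psiL_mul s hx hc₀ j hj'.le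
    obtain ⟨hr, hcomp, hrow, -⟩ := (admChain s).step ⟨j, hj'⟩
    refine ⟨c * (bkQScalar k ((admChain s).rs ⟨j, hj'⟩) ((admChain s).rs' ⟨j, hj'⟩) (contSeq k ((admChain s).tab j)))⁻¹,
      mul_ne_zero hc (inv_ne_zero (bkQScalar_ne_zero k _ _ _)), ?_⟩
    rw [psiL, dif_pos hj', mul_assoc]
    exact h.bkPsi_mul hr hcomp hrow

/-- **Hu–Mathas' Lemma 46 at level one: `ψ_{𝔰𝔱} ≡ c · m_{𝔰𝔱} (mod V(𝔰,𝔱))` for a nonzero scalar `c`**, i.e.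
`ψ_{𝔰𝔱} = c m_{𝔰𝔱} + ∑_{(𝔲,𝔳) ▷ (𝔰,𝔱)} r_{𝔲𝔳} m_{𝔲𝔳} (mod Ȟ^{▷λ})`. [cite: HuMathas2010, Lemma 46] -/
theorem exists_pairCong_psiElt (s t : StdFilling n μ.youngDiagram) :
    ∃ c : k, c ≠ 0 ∧ PairCong k s t (psiElt k s t) c := by
  obtain ⟨c₁, hc₁, h₁⟩ := exists_pairCong_mul_psiR k t (pairCong_eLam_mul_yLam k μ) (cLam_ne_zero k μ) _ le_rfl
  rw [(admChain t).tab_len] at h₁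
  obtain ⟨c₂, hc₂, h₂⟩ := exists_pairCong_psiL_mul k s h₁ hc₁ _ le_rfl
  rw [(admChain s).tab_len, ← mul_assoc] at h₂
  exact ⟨c₂, hc₂, h₂⟩

end PsiElt

/-! ### Degrees and contents of the `ψ_{𝔰𝔱}` (Hu–Mathas' Lemma 45 at level one) -/

section Degrees

variable {n : ℕ}

/-- Brundan–Kleshchev's Cartan integers agree with the degree Cartan integers (`p` prime). [folklore] -/
theorem klrCartan_eq_degCartan (p : ℕ) [Fact p.Prime] (i j : ZMod p) : klrCartan i j = degCartan p i j := by
  have key : (j = i - 1) ↔ (i = j + 1) := by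
    constructor <;> intro h
    · rw [h]; ring
    · rw [h]; ring
  unfold klrCartan degCartan
  simp only [key]
  by_cases hij : i = j
  · subst hij
    have h2 : ¬ (i = i + 1) := fun h => one_ne_zero (by linear_combination -h)
    simp [h2]
  · rw [if_neg hij, if_neg (Ne.symm hij)]
    split_ifs <;> omega

/-- The cells of the shape of the entries `≤ m` of `𝔱^λ` lie in the rows `≤ row_m`. [folklore] -/
theorem fst_le_of_mem_prefixCells_rowReading (μ : Nat.Partition n) (m : Fin n) {x : ℕ × ℕ}
    (hx : x ∈ prefixCells (rowReading μ).1 m) : x.1 ≤ μ.rowOf m := by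
  obtain ⟨e, he, rfl⟩ := Finset.mem_image.1 hx
  exact rowOf_mono μ (Finset.mem_filter.1 he).2

/-- The first cell of the row of `m` belongs to the shape of the entries `≤ m` of `𝔱^λ`. [folklore] -/
theorem rowStart_mem_prefixCells_rowReading (μ : Nat.Partition n) (m : Fin n) :
    (μ.rowOf m, 0) ∈ prefixCells (rowReading μ).1 m := by
  have hmem : (μ.rowOf m, 0) ∈ μ.youngDiagram :=
    μ.youngDiagram.up_left_mem le_rfl (Nat.zero_le _) ((rowReading μ).mem m)
  obtain ⟨e, he⟩ := (rowReading μ).exists_eq μ.card_cells_youngDiagram hmem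
  refine Finset.mem_image.2 ⟨e, Finset.mem_filter.2 ⟨Finset.mem_univ _, ?_⟩, he⟩
  by_contra hlt
  refine (rowReading μ).not_le (not_le.1 hlt) ?_
  rw [he, rowReading_apply]
  exact Prod.mk_le_mk.2 ⟨le_rfl, Nat.zero_le _⟩

/-- **The degree increments of `𝔱^λ`**: at the entry `m` (cell `(a, b)`) the shape of the entries
`≤ m` has exactly one addable node strictly below row `a`, namely `(a+1, 0)` of residue `-(a+1)`,
and no removable one; so the increment is `[p ∣ b + 1]`. [folklore] -/
theorem tableauDegreeStep_rowReading (p : ℕ) (μ : Nat.Partition n) (m : Fin n) :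
    tableauDegreeStep p (rowReading μ).1 m = if (μ.colOf m : ZMod p) + 1 = 0 then 1 else 0 := by
  set ν := prefixCells (rowReading μ).1 m with hν
  have hfm : (rowReading μ).1 m = (μ.rowOf m, μ.colOf m) := rfl
  have honly : ∀ B, IsAddableNode ν B → μ.rowOf m < B.1 → B = (μ.rowOf m + 1, 0) := by
    rintro ⟨r, c⟩ ⟨_, h1, h2⟩ hr
    simp only at hr h1 h2
    have h1' := h1.resolve_left (by omega)
    have hr' := fst_le_of_mem_prefixCells_rowReading μ m h1'
    simp only at hr'
    have hr1 : r = μ.rowOf m + 1 := by omega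
    subst hr1
    rcases h2 with hc | hc
    · subst hc; rfl
    · have := fst_le_of_mem_prefixCells_rowReading μ m hc
      simp only at this
      omega
  have hA : IsAddableNode ν (μ.rowOf m + 1, 0) := by
    refine ⟨fun hmem => ?_, Or.inr ?_, Or.inl rfl⟩
    · have := fst_le_of_mem_prefixCells_rowReading μ m hmem
      simp only at this
      omega
    · simpa using rowStart_mem_prefixCells_rowReading μ m
  have hadd : ((addableNodes ν).filter fun B => cellResidue p B = cellResidue p (μ.rowOf m, μ.colOf m) ∧ μ.rowOf m < B.1) =
      if cellResidue p (μ.rowOf m + 1, 0) = cellResidue p (μ.rowOf m, μ.colOf m) then {(μ.rowOf m + 1, 0)} else ∅ := by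
    ext B
    rw [Finset.mem_filter, mem_addableNodes]
    split_ifs with hres
    · rw [Finset.mem_singleton]
      constructor
      · rintro ⟨hB, -, hlt⟩; exact honly B hB hlt
      · rintro rfl; exact ⟨hA, hres, by simp⟩
    · simp only [Finset.notMem_empty, iff_false, not_and]
      intro hB hres' hlt
      exact hres (honly B hB hlt ▸ hres')
  have hrem : ((removableNodes ν).filter fun B => cellResidue p B = cellResidue p (μ.rowOf m, μ.colOf m) ∧ μ.rowOf m < B.1) = ∅ := by
    refine Finset.filter_eq_empty_iff.2 fun B hB hcond => ?_
    have := fst_le_of_mem_prefixCells_rowReading μ m (mem_removableNodes.1 hB).1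
    omega
  have hres_iff : cellResidue p (μ.rowOf m + 1, 0) = cellResidue p (μ.rowOf m, μ.colOf m) ↔ (μ.colOf m : ZMod p) + 1 = 0 := by
    simp only [cellResidue]
    push_cast
    constructor
    · intro h; linear_combination -h
    · intro h; linear_combination -h
  unfold tableauDegreeStep
  rw [hfm]
  simp only
  rw [hadd, hrem, Finset.card_empty]
  by_cases hb : (μ.colOf m : ZMod p) + 1 = 0
  · rw [if_pos (hres_iff.2 hb), if_pos hb, Finset.card_singleton]; norm_num
  · rw [if_neg (mt hres_iff.1 hb), if_neg hb, Finset.card_empty]; norm_num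

/-- **`deg 𝔱^λ = #{m : p ∣ col_m + 1}`** (BKW's degree, Hu–Mathas Def. 34, of `𝔱^λ`; cf. their Lemma 37).
[cite: HuMathas2010, Def. 34, Lemma 37] -/
theorem tableauDegree_rowReading (p : ℕ) (μ : Nat.Partition n) :
    tableauDegree p (rowReading μ).1 = ∑ m : Fin n, if (μ.colOf m : ZMod p) + 1 = 0 then (1 : ℤ) else 0 :=
  Finset.sum_congr rfl fun m _ => tableauDegreeStep_rowReading p μ m

/-- The degree of `y_λ` accumulated over the entries `< m`. [folklore] -/
def yLamDegN (p : ℕ) (μ : Nat.Partition n) : ℕ → ℤ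
  | 0 => 0
  | m + 1 => yLamDegN p μ m + if h : m < n then (if (μ.colOf ⟨m, h⟩ : ZMod p) + 1 = 0 then 2 else 0) else 0

/-- `yLamDegN m = 2 #{i < m : p ∣ col_i + 1}`. [folklore] -/
theorem yLamDegN_eq (p : ℕ) (μ : Nat.Partition n) : ∀ m, m ≤ n → yLamDegN p μ m =
    2 * ∑ i ∈ Finset.univ.filter (fun i : Fin n => (i : ℕ) < m), (if (μ.colOf i : ZMod p) + 1 = 0 then (1 : ℤ) else 0)
  | 0, _ => by
    rw [yLamDegN, show (Finset.univ.filter fun i : Fin n => (i : ℕ) < 0) = ∅ by ext i; simp, Finset.sum_empty, mul_zero]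
  | m + 1, hm => by
    have hm' : m < n := hm
    rw [yLamDegN, dif_pos hm', yLamDegN_eq p μ m hm'.le]
    have hset : (Finset.univ.filter fun i : Fin n => (i : ℕ) < m + 1) =
        insert ⟨m, hm'⟩ (Finset.univ.filter fun i : Fin n => (i : ℕ) < m) := by
      ext i
      simp only [Finset.mem_filter, Finset.mem_univ, true_and, Finset.mem_insert, Fin.ext_iff]
      omega
    rw [hset, Finset.sum_insert (by simp)]
    split_ifs <;> ring

/-- **`deg y_λ = 2 deg 𝔱^λ`** (as a count). [cite: HuMathas2010, Cor. 42] -/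
theorem yLamDegN_n (p : ℕ) (μ : Nat.Partition n) : yLamDegN p μ n = 2 * tableauDegree p (rowReading μ).1 := by
  rw [yLamDegN_eq p μ n le_rfl, tableauDegree_rowReading]
  congr 1
  exact Finset.sum_congr (by ext i; simp) fun _ _ => rfl

/-- Over `𝔽_p` the content sequence is the residue sequence. [folklore] -/
theorem contSeq_zmod_eq_residueSeq (p : ℕ) [Fact p.Prime] {Y : YoungDiagram} (t : StdFilling n Y) :
    contSeq (ZMod p) t = residueSeq p t := by
  funext r
  simp only [contSeq, jmContent, residueSeq_apply, cellResidue]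

variable (k : Type*) [Field k] [DecidableEq k] (p : ℕ) [Fact p.Prime] [CharP k p] {μ : Nat.Partition n}

omit [DecidableEq k] [Fact p.Prime] in
/-- The content sequence in `k` is the cast residue sequence. [folklore] -/
theorem contSeq_eq_resCast {Y : YoungDiagram} (t : StdFilling n Y) : contSeq k t = resCast k p n (residueSeq p t) := by
  funext r
  simp only [contSeq, jmContent, resCast, Function.comp_apply, residueSeq_apply, cellResidue, map_sub, map_natCast]

omit [DecidableEq k] in
/-- `p ∣ col_m + 1` in `k` and in `ZMod p`. [folklore] -/
theorem colSucc_eq_zero_iff (μ : Nat.Partition n) (m : Fin n) : colSucc k μ m = 0 ↔ (μ.colOf m : ZMod p) + 1 = 0 := by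
  rw [colSucc, show (μ.colOf m : k) + 1 = ((μ.colOf m + 1 : ℕ) : k) by push_cast; ring, CharP.cast_eq_zero_iff k p,
    show (μ.colOf m : ZMod p) + 1 = ((μ.colOf m + 1 : ℕ) : ZMod p) by push_cast; ring, CharP.cast_eq_zero_iff (ZMod p) p]

/-- `e_λ` has degree `0`. [folklore] -/
theorem eLam_mem_groupAlgDegPart (μ : Nat.Partition n) : eLam k μ ∈ groupAlgDegPart k p 0 := by
  rw [eLam, contSeq_eq_resCast k p]
  exact klrIdempotent_mem_groupAlgDegPart k p _

/-- `y'_m` has degree `2 [p ∣ col_m + 1]`. [folklore] -/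
theorem yLamFactor_mem_groupAlgDegPart (μ : Nat.Partition n) (m : Fin n) :
    yLamFactor k μ m ∈ groupAlgDegPart k p (if (μ.colOf m : ZMod p) + 1 = 0 then 2 else 0) := by
  unfold yLamFactor
  by_cases hc : (μ.colOf m : ZMod p) + 1 = 0
  · have hc' : colSucc k μ m = 0 := (colSucc_eq_zero_iff k p μ m).2 hc
    simp only [hc, hc', if_true]
    exact bkNilpotent_mem_groupAlgDegPart k p m
  · have hc' : ¬ colSucc k μ m = 0 := mt (colSucc_eq_zero_iff k p μ m).1 hc
    simp only [hc, hc', if_false]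
    exact one_mem_groupAlgDegPart k p

/-- `∏_{m'<m} y'_{m'}` has degree `yLamDegN m`. [folklore] -/
theorem yLamProd_mem_groupAlgDegPart (μ : Nat.Partition n) : ∀ m, yLamProd k μ m ∈ groupAlgDegPart k p (yLamDegN p μ m)
  | 0 => by rw [yLamProd, yLamDegN]; exact one_mem_groupAlgDegPart k p
  | m + 1 => by
    rw [yLamProd, yLamDegN]
    refine mul_mem_groupAlgDegPart k p (yLamProd_mem_groupAlgDegPart μ m) ?_
    by_cases hm : m < n
    · rw [dif_pos hm, dif_pos hm]
      exact yLamFactor_mem_groupAlgDegPart k p μ ⟨m, hm⟩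
    · rw [dif_neg hm, dif_neg hm]
      exact one_mem_groupAlgDegPart k p

/-- **`e_λ y_λ` is homogeneous of degree `2 deg 𝔱^λ`.** [cite: HuMathas2010, Cor. 42] -/
theorem eLam_mul_yLam_mem_groupAlgDegPart (μ : Nat.Partition n) :
    eLam k μ * yLam k μ ∈ groupAlgDegPart k p (2 * tableauDegree p (rowReading μ).1) := by
  have := mul_mem_groupAlgDegPart k p (eLam_mem_groupAlgDegPart k p μ) (yLamProd_mem_groupAlgDegPart k p μ n)
  rwa [zero_add, yLamDegN_n] at this

/-- **`e_λ ψ_{r_0} ⋯ ψ_{r_{j-1}} = e(𝐢^{𝔱^λ}) ψ_{r_0} ⋯ ψ_{r_{j-1}} e(𝐢^{𝔱_j})` is homogeneous of degree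
`deg 𝔱_j - deg 𝔱^λ`** (BKW Prop. 3.14/Cor. 3.15 through `tableauDegree_swap_sub_of_stdFilling`).
[cite: HuMathas2010, Lemma 45] -/
theorem eLam_mul_psiR_mem (t : StdFilling n μ.youngDiagram) : ∀ j, j ≤ (admChain t).len →
    eLam k μ * psiR k t j ∈ groupAlgDegPart k p (tableauDegree p ((admChain t).tab j).1 - tableauDegree p (rowReading μ).1) ∧
    eLam k μ * psiR k t j = eLam k μ * psiR k t j * klrIdempotent k (contSeq k ((admChain t).tab j))
  | 0, _ => by
    rw [psiR, mul_one, (admChain t).tab_zero, sub_self]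
    exact ⟨eLam_mem_groupAlgDegPart k p μ, by rw [eLam, klrIdempotent_mul_self]⟩
  | j + 1, hj => by
    have hj' : j < (admChain t).len := hj
    obtain ⟨hmem, hform⟩ := eLam_mul_psiR_mem t j hj'.le
    obtain ⟨hr, hcomp, hrow, hcol⟩ := (admChain t).step ⟨j, hj'⟩
    rw [psiR, dif_pos hj']
    generalize (admChain t).rs ⟨j, hj'⟩ = r at hr hcomp hrow hcol ⊢
    generalize (admChain t).rs' ⟨j, hj'⟩ = r' at hr hcomp hrow hcol ⊢
    have hT : ((admChain t).tab (↑(⟨j, hj'⟩ : Fin (admChain t).len) + 1)) = (admChain t).tab (j + 1) := rfl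
    have hT' : ((admChain t).tab (↑(⟨j, hj'⟩ : Fin (admChain t).len))) = (admChain t).tab j := rfl
    rw [hT, hT'] at hcomp
    rw [hT'] at hrow hcol
    have hχ : contSeq k ((admChain t).tab (j + 1)) ∘ ⇑(swap r r') = contSeq k ((admChain t).tab j) := by
      rw [contSeq_of_comp_swap hcomp]; funext i; simp only [Function.comp_apply, swap_apply_self]
    have hswap : klrIdempotent k (contSeq k ((admChain t).tab j)) * bkPsi k r r' =
        bkPsi k r r' * klrIdempotent k (contSeq k ((admChain t).tab (j + 1))) := by
      rw [← hχ, ← bkPsi_mul_klrIdempotent_eq k hr]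
    have e1 : eLam k μ * (psiR k t j * bkPsi k r r') =
        (eLam k μ * psiR k t j) * (bkPsi k r r' * klrIdempotent k (contSeq k ((admChain t).tab (j + 1)))) := by
      conv_lhs => rw [← mul_assoc, hform, mul_assoc (eLam k μ * psiR k t j), hswap]
    refine ⟨?_, by rw [e1]; simp only [mul_assoc, klrIdempotent_mul_self]⟩
    rw [e1]
    have hψ : bkPsi k r r' * klrIdempotent k (contSeq k ((admChain t).tab (j + 1))) ∈
        groupAlgDegPart k p (-klrCartan (residueSeq p ((admChain t).tab (j + 1)) r) (residueSeq p ((admChain t).tab (j + 1)) r')) := by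
      rw [contSeq_eq_resCast k p]
      exact bkPsi_mul_klrIdempotent_mem_groupAlgDegPart k p hr _
    have hd := tableauDegree_swap_sub_of_stdFilling p μ.card_cells_youngDiagram ((admChain t).tab j) hr hrow hcol
    rw [← hcomp] at hd
    have hres1 : residueSeq p ((admChain t).tab (j + 1)) r = cellResidue p (((admChain t).tab j).1 r') := by
      rw [residueSeq_apply, hcomp, Function.comp_apply, swap_apply_left]
    have hres2 : residueSeq p ((admChain t).tab (j + 1)) r' = cellResidue p (((admChain t).tab j).1 r) := by
      rw [residueSeq_apply, hcomp, Function.comp_apply, swap_apply_right]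
    rw [hres1, hres2, klrCartan_symm, klrCartan_eq_degCartan] at hψ
    have heq : tableauDegree p ((admChain t).tab (j + 1)).1 - tableauDegree p (rowReading μ).1 =
        (tableauDegree p ((admChain t).tab j).1 - tableauDegree p (rowReading μ).1) +
          -degCartan p (cellResidue p (((admChain t).tab j).1 r)) (cellResidue p (((admChain t).tab j).1 r')) := by
      linarith
    rw [heq]
    exact mul_mem_groupAlgDegPart k p hmem hψ

/-- **`ψ_{r_{j-1}} ⋯ ψ_{r_0} e_λ = e(𝐢^{𝔰_j}) ψ_{r_{j-1}} ⋯ ψ_{r_0} e(𝐢^{𝔱^λ})` is homogeneous of degree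
`deg 𝔰_j - deg 𝔱^λ`.** [cite: HuMathas2010, Lemma 45] -/
theorem psiL_mul_eLam_mem (s : StdFilling n μ.youngDiagram) : ∀ j, j ≤ (admChain s).len →
    psiL k s j * eLam k μ ∈ groupAlgDegPart k p (tableauDegree p ((admChain s).tab j).1 - tableauDegree p (rowReading μ).1) ∧
    psiL k s j * eLam k μ = klrIdempotent k (contSeq k ((admChain s).tab j)) * (psiL k s j * eLam k μ)
  | 0, _ => by
    rw [psiL, one_mul, (admChain s).tab_zero, sub_self]
    exact ⟨eLam_mem_groupAlgDegPart k p μ, by rw [eLam, klrIdempotent_mul_self]⟩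
  | j + 1, hj => by
    have hj' : j < (admChain s).len := hj
    obtain ⟨hmem, hform⟩ := psiL_mul_eLam_mem s j hj'.le
    obtain ⟨hr, hcomp, hrow, hcol⟩ := (admChain s).step ⟨j, hj'⟩
    rw [psiL, dif_pos hj']
    generalize (admChain s).rs ⟨j, hj'⟩ = r at hr hcomp hrow hcol ⊢
    generalize (admChain s).rs' ⟨j, hj'⟩ = r' at hr hcomp hrow hcol ⊢
    have hT : ((admChain s).tab (↑(⟨j, hj'⟩ : Fin (admChain s).len) + 1)) = (admChain s).tab (j + 1) := rfl
    have hT' : ((admChain s).tab (↑(⟨j, hj'⟩ : Fin (admChain s).len))) = (admChain s).tab j := rfl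
    rw [hT, hT'] at hcomp
    rw [hT'] at hrow hcol
    have hswap : bkPsi k r r' * klrIdempotent k (contSeq k ((admChain s).tab j)) =
        klrIdempotent k (contSeq k ((admChain s).tab (j + 1))) * bkPsi k r r' := by
      rw [bkPsi_mul_klrIdempotent_eq k hr, ← contSeq_of_comp_swap hcomp]
    have e1 : bkPsi k r r' * psiL k s j * eLam k μ =
        (bkPsi k r r' * klrIdempotent k (contSeq k ((admChain s).tab j))) * (psiL k s j * eLam k μ) := by
      rw [mul_assoc, hform, ← mul_assoc, ← hform]
    have hee : ∀ z : MonoidAlgebra k (Perm (Fin n)), klrIdempotent k (contSeq k ((admChain s).tab (j + 1))) *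
        (klrIdempotent k (contSeq k ((admChain s).tab (j + 1))) * z) = klrIdempotent k (contSeq k ((admChain s).tab (j + 1))) * z :=
      fun z => by rw [← mul_assoc, klrIdempotent_mul_self]
    refine ⟨?_, by rw [e1, hswap]; simp only [mul_assoc, hee]⟩
    rw [e1]
    have hψ : bkPsi k r r' * klrIdempotent k (contSeq k ((admChain s).tab j)) ∈
        groupAlgDegPart k p (-klrCartan (residueSeq p ((admChain s).tab j) r) (residueSeq p ((admChain s).tab j) r')) := by
      rw [contSeq_eq_resCast k p]
      exact bkPsi_mul_klrIdempotent_mem_groupAlgDegPart k p hr _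
    have hd := tableauDegree_swap_sub_of_stdFilling p μ.card_cells_youngDiagram ((admChain s).tab j) hr hrow hcol
    rw [← hcomp] at hd
    rw [residueSeq_apply, residueSeq_apply, klrCartan_eq_degCartan] at hψ
    have heq : tableauDegree p ((admChain s).tab (j + 1)).1 - tableauDegree p (rowReading μ).1 =
        -degCartan p (cellResidue p (((admChain s).tab j).1 r)) (cellResidue p (((admChain s).tab j).1 r')) +
          (tableauDegree p ((admChain s).tab j).1 - tableauDegree p (rowReading μ).1) := by
      linarith
    rw [heq]
    exact mul_mem_groupAlgDegPart k p hψ hmem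

omit [DecidableEq k] in
/-- `e_λ e_λ = e_λ`. [folklore] -/
theorem eLam_mul_self (μ : Nat.Partition n) : eLam k μ * eLam k μ = eLam k μ := klrIdempotent_mul_self k _

/-- **Hu–Mathas' Lemma 45 at level one: `ψ_{𝔰𝔱}` is homogeneous of degree `deg 𝔰 + deg 𝔱`.**
[cite: HuMathas2010, Lemma 45] -/
theorem psiElt_mem_groupAlgDegPart (s t : StdFilling n μ.youngDiagram) :
    psiElt k s t ∈ groupAlgDegPart k p (tableauDegree p s.1 + tableauDegree p t.1) := by
  obtain ⟨hL, -⟩ := psiL_mul_eLam_mem k p s _ le_rfl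
  obtain ⟨hR, -⟩ := eLam_mul_psiR_mem k p t _ le_rfl
  rw [(admChain s).tab_len] at hL
  rw [(admChain t).tab_len] at hR
  have e1 : psiElt k s t = (psiL k s (admChain s).len * eLam k μ) * (eLam k μ * yLam k μ) * (eLam k μ * psiR k t (admChain t).len) := by
    have h3 : eLam k μ * yLam k μ = eLam k μ * (eLam k μ * yLam k μ) * eLam k μ := by
      conv_rhs => rw [← mul_assoc (eLam k μ) (eLam k μ), eLam_mul_self, mul_assoc, ← eLam_mul_yLam, ← mul_assoc, eLam_mul_self]
    rw [psiElt]
    conv_lhs => rw [h3]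
    simp only [mul_assoc]
  have heq : tableauDegree p s.1 + tableauDegree p t.1 = (tableauDegree p s.1 - tableauDegree p (rowReading μ).1) +
      2 * tableauDegree p (rowReading μ).1 + (tableauDegree p t.1 - tableauDegree p (rowReading μ).1) := by ring
  rw [e1, heq]
  exact mul_mem_groupAlgDegPart k p (mul_mem_groupAlgDegPart k p hL (eLam_mul_yLam_mem_groupAlgDegPart k p μ)) hR

omit [Fact p.Prime] [CharP k p] in
/-- **`ψ_{𝔰𝔱}` lies in the block of the content of `λ`** (`e_λ ∈ M_{𝐢^λ}`, a two-sided ideal sum).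
[cite: HuMathas2010, Lemma 44] -/
theorem psiElt_mem_contentSpace (s t : StdFilling n μ.youngDiagram) :
    psiElt k s t ∈ contentSpace k (seqContent k (contSeq k (rowReading μ))) := by
  rw [psiElt, mul_assoc]
  refine mul_mem_contentSpace_left k _ (mul_mem_contentSpace k (mul_mem_contentSpace k ?_ _) _)
  exact jointEigenspace_le_contentSpace k _ (klrIdempotent_mem k _)

/-- **`ψ_{𝔰𝔱} ∈ e_{cont λ} 𝔽_p[S_n]_{deg 𝔰 + deg 𝔱}`.** [cite: HuMathas2010, Lemma 44, Lemma 45] -/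
theorem psiElt_mem_gradedBlock (μ : Nat.Partition n) (s t : StdFilling n μ.youngDiagram) :
    psiElt (ZMod p) s t ∈ gradedBlock (ZMod p) p (residueContent p μ) (tableauDegree p s.1 + tableauDegree p t.1) := by
  refine ⟨psiElt_mem_groupAlgDegPart (ZMod p) p s t, ?_⟩
  rw [← seqContent_residueSeq p μ (rowReading μ), ← contSeq_zmod_eq_residueSeq]
  exact psiElt_mem_contentSpace (ZMod p) s t

end Degrees

/-! ### Linear independence of the `ψ_{𝔰𝔱}` (the triangularity argument of Hu–Mathas' Thm 49) -/

section Independence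

variable {n : ℕ}

/-- **A linear height on index pairs** refining the cellular order: shapes by the numeric dominance
potential `∑_t C_t(λ)` (strictly smaller for strictly dominating shapes), then pairs of the same
shape by the dominance potentials of the two tableaux. [folklore] -/
def pairHeight (T : TableauPair n) : ℕ :=
  (2 * ((n + 1) * ((n + 1) * n)) + 1) * (∑ t ∈ Finset.range (n + 1), colCount T.1.rowOf t) +
    (2 * ((n + 1) * ((n + 1) * n)) - (domPot T.2.1.1 + domPot T.2.2.1))

/-- A pair of a strictly dominating shape has smaller height. [folklore] -/
theorem pairHeight_lt_of_labSDom (T T' : TableauPair n) (h : LabSDom T'.1.rowOf T.1.rowOf) :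
    pairHeight T' < pairHeight T := by
  have hlt := sum_colCount_lt_of_labSDom h
  have hle : 2 * ((n + 1) * ((n + 1) * n)) - (domPot T'.2.1.1 + domPot T'.2.2.1) ≤ 2 * ((n + 1) * ((n + 1) * n)) :=
    Nat.sub_le _ _
  unfold pairHeight
  nlinarith

/-- The prefix counts only see `k, i ≤ n`. [folklore] -/
theorem rowCount_clamp (f : Fin n → ℕ × ℕ) (hf : ∀ e, (f e).1 < n) (k i : ℕ) :
    rowCount f k i = rowCount f (min k n) (min i n) := by
  unfold rowCount
  congr 1
  ext e
  simp only [Finset.mem_filter, Finset.mem_univ, true_and]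
  have h1 := e.2
  have h2 := hf e
  constructor
  · rintro ⟨hk, hi⟩; exact ⟨lt_min hk h1, le_min hi h2.le⟩
  · rintro ⟨hk, hi⟩
    exact ⟨lt_of_lt_of_le hk (min_le_left _ _), by
      rcases le_total i n with hin | hin
      · rw [min_eq_left hin] at hi; exact hi
      · omega⟩

/-- Dominance bounds the potentials. [folklore] -/
theorem domPot_le_of_dom {f g : Fin n → ℕ × ℕ} (h : FillingDominates f g) : domPot g ≤ domPot f :=
  Finset.sum_le_sum fun k _ => Finset.sum_le_sum fun i _ => h k i

/-- **Strict dominance of standard tableaux strictly raises the potential.** [folklore] -/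
theorem domPot_lt_of_stdSDom {μ : Nat.Partition n} {u s : StdFilling n μ.youngDiagram} (h : StdSDom u s) :
    domPot s.1 < domPot u.1 := by
  refine lt_of_le_of_ne (domPot_le_of_dom h.1) fun heq => h.2 ?_
  -- all clamped counts agree, hence all counts, hence the rows
  have hterm : ∀ k ∈ Finset.range (n + 1), ∀ i ∈ Finset.range (n + 1), rowCount s.1 k i = rowCount u.1 k i := by
    have h1 := (Finset.sum_eq_sum_iff_of_le (fun k _ => Finset.sum_le_sum fun i _ => h.1 k i)).1 heq
    intro k hk i hi
    exact (Finset.sum_eq_sum_iff_of_le (fun i _ => h.1 k i)).1 (h1 k hk) i hi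
  have hrow_s : ∀ e, (s.1 e).1 < n := fun e => lt_of_le_of_lt (cell_le_of_stdFilling μ.card_cells_youngDiagram s e).1 e.2
  have hrow_u : ∀ e, (u.1 e).1 < n := fun e => lt_of_le_of_lt (cell_le_of_stdFilling μ.card_cells_youngDiagram u e).1 e.2
  refine StdFilling.ext_of_row_eq μ.card_cells_youngDiagram fun e => (row_eq_of_rowCount_eq (fun k i => ?_) e)
  rw [rowCount_clamp u.1 hrow_u, rowCount_clamp s.1 hrow_s]
  exact (hterm _ (Finset.mem_range.2 (Nat.lt_succ_of_le (min_le_right _ _))) _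
    (Finset.mem_range.2 (Nat.lt_succ_of_le (min_le_right _ _)))).symm

/-- **The error pairs of `V(𝔰,𝔱)` have smaller height.** [folklore] -/
theorem pairHeight_lt_of_pair {μ : Nat.Partition n} {s t u v : StdFilling n μ.youngDiagram} (hu : FillingDominates u.1 s.1)
    (hv : FillingDominates v.1 t.1) (hne : u ≠ s ∨ v ≠ t) :
    pairHeight ⟨μ, u, v⟩ < pairHeight ⟨μ, s, t⟩ := by
  have hu' := domPot_le_of_dom hu
  have hv' := domPot_le_of_dom hv
  have hstrict : domPot s.1 + domPot t.1 < domPot u.1 + domPot v.1 := by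
    rcases hne with hne | hne
    · have := domPot_lt_of_stdSDom ⟨hu, hne⟩; omega
    · have := domPot_lt_of_stdSDom ⟨hv, hne⟩; omega
  have hbu := domPot_le u.1
  have hbv := domPot_le v.1
  unfold pairHeight
  simp only
  omega

variable (k : Type*) [Field k] [DecidableEq k]

/-- The span of the Murphy elements of smaller height. [folklore] -/
def errSpan (T : TableauPair n) : Submodule k (MonoidAlgebra k (Perm (Fin n))) :=
  Submodule.span k {x | ∃ T' : TableauPair n, pairHeight T' < pairHeight T ∧ x = murphy k T'.2.1 T'.2.2}

omit [DecidableEq k] in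
/-- **`V(𝔰,𝔱)` is spanned by Murphy elements of smaller height** (`J^{▷λ} ⊆ Ȟ^{▷λ}` is spanned by the
`m_{𝔲𝔳}` of strictly dominating shapes). [folklore] -/
theorem pairUpper_le_errSpan {μ : Nat.Partition n} (s t : StdFilling n μ.youngDiagram) :
    pairUpper k s t ≤ errSpan k ⟨μ, s, t⟩ := by
  refine sup_le ?_ ((domIdeal_le_murphySpanSDom k μ.rowOf).trans ?_)
  · rw [Submodule.span_le]
    rintro x ⟨u, v, hu, hv, hne, rfl⟩
    exact Submodule.subset_span ⟨⟨μ, u, v⟩, pairHeight_lt_of_pair hu hv hne, rfl⟩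
  · rw [murphySpanSDom, Submodule.span_le]
    rintro x ⟨μ', u, v, hsdom, rfl⟩
    exact Submodule.subset_span ⟨⟨μ', u, v⟩, pairHeight_lt_of_labSDom ⟨μ, s, t⟩ ⟨μ', u, v⟩ hsdom, rfl⟩

/-- **The `ψ_{𝔰𝔱}`, `(λ, 𝔰, 𝔱)` over all index pairs, are linearly independent** (their transition
matrix to the Murphy basis is triangular with nonzero diagonal for the height order; Hu–Mathas 2010,
proof of Thm 49). [cite: HuMathas2010, Thm 49 (proof)] -/
theorem linearIndependent_psiElt (n : ℕ) :
    LinearIndependent k (fun T : TableauPair n => psiElt k T.2.1 T.2.2) := by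
  classical
  rw [linearIndependent_iff']
  intro s g hrel
  by_contra hex
  push Not at hex
  obtain ⟨i₀, hi₀, hgi₀⟩ := hex
  set S' := s.filter fun i => g i ≠ 0 with hS'def
  have hS' : S'.Nonempty := ⟨i₀, Finset.mem_filter.2 ⟨hi₀, hgi₀⟩⟩
  obtain ⟨T₀, hT₀, hmax⟩ := Finset.exists_max_image S' pairHeight hS'
  let φ : MonoidAlgebra k (Perm (Fin n)) →ₗ[k] k := (Finsupp.lapply T₀).comp (murphyBasis k n).repr.toLinearMap
  have hφm : ∀ T : TableauPair n, φ (murphy k T.2.1 T.2.2) = if T = T₀ then 1 else 0 := by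
    intro T
    rw [← murphyBasis_apply]
    simp only [φ, LinearMap.comp_apply, LinearEquiv.coe_toLinearMap, Module.Basis.repr_self, Finsupp.lapply_apply,
      Finsupp.single_apply]
  have hφerr : ∀ T : TableauPair n, pairHeight T ≤ pairHeight T₀ → ∀ x ∈ errSpan k T, φ x = 0 := by
    intro T hT x hx
    induction hx using Submodule.span_induction with
    | mem x hx =>
      obtain ⟨T', hT', rfl⟩ := hx
      rw [hφm, if_neg]
      rintro rfl
      omega
    | zero => exact map_zero φ
    | add x y _ _ hx hy => rw [map_add, hx, hy, add_zero]
    | smul c x _ hx => rw [map_smul, hx, smul_zero]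
  have hφψ : ∀ T ∈ S', ∃ c : k, c ≠ 0 ∧ φ (psiElt k T.2.1 T.2.2) = if T = T₀ then c else 0 := by
    intro T hT
    obtain ⟨c, hc, hcong⟩ := exists_pairCong_psiElt k T.2.1 T.2.2
    refine ⟨c, hc, ?_⟩
    have herr : psiElt k T.2.1 T.2.2 - c • murphy k T.2.1 T.2.2 ∈ errSpan k T := pairUpper_le_errSpan k T.2.1 T.2.2 hcong
    have h0 := hφerr T (hmax T hT) _ herr
    rw [map_sub, map_smul, hφm, sub_eq_zero] at h0
    rw [h0]
    split_ifs <;> simp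
  have hval := congrArg φ hrel
  rw [map_sum, map_zero, ← Finset.sum_filter_add_sum_filter_not s (fun i => g i ≠ 0)] at hval
  have hzero : ∑ i ∈ s.filter (fun i => ¬ g i ≠ 0), φ (g i • psiElt k i.2.1 i.2.2) = 0 :=
    Finset.sum_eq_zero fun i hi => by
      rw [Finset.mem_filter, not_not] at hi
      rw [hi.2, zero_smul, map_zero]
  rw [hzero, add_zero, ← hS'def] at hval
  obtain ⟨c₀, hc₀, hφT₀⟩ := hφψ T₀ hT₀
  have hsum : ∑ i ∈ S', φ (g i • psiElt k i.2.1 i.2.2) = g T₀ * c₀ := by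
    rw [← Finset.add_sum_erase _ _ hT₀, map_smul, hφT₀, if_pos rfl, smul_eq_mul, Finset.sum_eq_zero, add_zero]
    intro i hi
    obtain ⟨hine, hiS⟩ := Finset.mem_erase.1 hi
    obtain ⟨c, -, hφi⟩ := hφψ i hiS
    rw [map_smul, hφi, if_neg hine, smul_zero]
  rw [hsum] at hval
  exact (Finset.mem_filter.1 hT₀).2 ((mul_eq_zero.1 hval).resolve_right hc₀)

end Independence


/-! ### Counting: the graded dimensions of the blocks, and the fact -/

section Counting

variable {n : ℕ}

/-- **Finitely many independent subspaces have total dimension at most the ambient dimension.**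
[folklore] -/
theorem sum_finrank_le_of_iSupIndep {K V ι : Type*} [Field K] [AddCommGroup V] [Module K V] [FiniteDimensional K V]
    [DecidableEq ι] {N : ι → Submodule K V} (hN : iSupIndep N) (S : Finset ι) :
    ∑ i ∈ S, Module.finrank K (N i) ≤ Module.finrank K V := by
  suffices H : ∑ i ∈ S, Module.finrank K (N i) = Module.finrank K (⨆ i ∈ S, N i : Submodule K V) by
    rw [H]; exact Submodule.finrank_le _
  induction S using Finset.induction_on with
  | empty => rw [Finset.sum_empty, show (⨆ i ∈ (∅ : Finset ι), N i) = ⊥ by simp, finrank_bot]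
  | insert a S ha ih =>
    rw [Finset.sum_insert ha, ih, Finset.iSup_insert]
    have hdis : Disjoint (N a) (⨆ i ∈ S, N i) := by
      have := hN.disjoint_biSup (y := (S : Set ι)) (x := a) (by exact_mod_cast ha)
      simpa using this
    have key := Submodule.finrank_sup_add_finrank_inf_eq (N a) (⨆ i ∈ S, N i)
    rw [disjoint_iff.1 hdis, finrank_bot, add_zero] at key
    exact key.symm

/-- **The graded dimension formula for the blocks of `𝔽_p S_n`** (Hu–Mathas 2010, Main Theorem /
Thm 49 at level one, through the `ψ`-basis): `dim e_α 𝔽_p[S_n]_e = #{(λ,𝔰,𝔱) : cont λ = α,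
deg 𝔰 + deg 𝔱 = e}` — the `ψ_{𝔰𝔱}` of these index pairs are independent elements of the block
(`≤`), and both sides sum to `n!` over the finitely many blocks (`≥`). [cite: HuMathas2010, Thm 49] -/
theorem finrank_gradedBlock_eq_card (p : ℕ) [Fact p.Prime] (n : ℕ) (α : ZMod p → ℕ) (e : ℤ) :
    Module.finrank (ZMod p) (gradedBlock (ZMod p) p (n := n) α e) =
      Fintype.card {t : TableauPair n // TableauPair.content p t = α ∧ TableauPair.degree p t = e} := by
  classical
  -- notation
  let N : (ZMod p → ℕ) × ℤ → Submodule (ZMod p) (MonoidAlgebra (ZMod p) (Perm (Fin n))) := fun ae => gradedBlock (ZMod p) p ae.1 ae.2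
  let f : TableauPair n → (ZMod p → ℕ) × ℤ := fun t => (TableauPair.content p t, TableauPair.degree p t)
  let a : (ZMod p → ℕ) × ℤ → ℕ := fun ae => Fintype.card {t : TableauPair n // f t = ae}
  let b : (ZMod p → ℕ) × ℤ → ℕ := fun ae => Module.finrank (ZMod p) (N ae)
  -- (i) `a ≤ b`: the `ψ_T` with `f T = ae` are independent elements of `N ae`
  have hmem : ∀ T : TableauPair n, psiElt (ZMod p) T.2.1 T.2.2 ∈ N (f T) := by
    intro T
    have h := psiElt_mem_gradedBlock p T.1 T.2.1 T.2.2
    have hc : TableauPair.content p T = residueContent p T.1 := rfl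
    have hd : TableauPair.degree p T = tableauDegree p T.2.1.1 + tableauDegree p T.2.2.1 := rfl
    simp only [N, f, hc, hd]
    exact h
  have hab : ∀ ae, a ae ≤ b ae := by
    intro ae
    let v : {t : TableauPair n // f t = ae} → N ae := fun T => ⟨psiElt (ZMod p) T.1.2.1 T.1.2.2, by
      have h := hmem T.1
      rw [T.2] at h
      exact h⟩
    have hv : LinearIndependent (ZMod p) v := by
      refine LinearIndependent.of_comp (N ae).subtype ?_
      exact (linearIndependent_psiElt (ZMod p) n).comp (fun T : {t : TableauPair n // f t = ae} => T.1) Subtype.val_injective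
    exact hv.fintype_card_le_finrank
  -- (ii) `∑_S a = n!` over `S = image f`
  set S := (Finset.univ : Finset (TableauPair n)).image f with hSdef
  have hsum_a : ∑ ae ∈ S, a ae = n.factorial := by
    rw [← card_tableauPair n, ← Finset.card_univ, Finset.card_eq_sum_card_image f Finset.univ]
    refine Finset.sum_congr rfl fun ae _ => ?_
    simp only [a, Fintype.card_subtype]
  -- (iii) `∑_{S'} b ≤ n!` for every finite `S'`
  have hsum_b : ∀ S' : Finset ((ZMod p → ℕ) × ℤ), ∑ ae ∈ S', b ae ≤ n.factorial := by
    intro S'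
    rw [← finrank_monoidAlgebra_perm_eq_factorial (ZMod p) (n := n)]
    exact sum_finrank_le_of_iSupIndep (iSupIndep_gradedBlock (ZMod p) p) S'
  -- (iv) equality on `S`, vanishing off `S`
  have heqS : ∀ ae ∈ S, a ae = b ae := by
    have hle : ∑ ae ∈ S, b ae ≤ ∑ ae ∈ S, a ae := by rw [hsum_a]; exact hsum_b S
    have hge : ∑ ae ∈ S, a ae ≤ ∑ ae ∈ S, b ae := Finset.sum_le_sum fun ae _ => hab ae
    exact (Finset.sum_eq_sum_iff_of_le fun ae _ => hab ae).1 (le_antisymm hge hle)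
  have hgoal : b (α, e) = a (α, e) := by
    by_cases hS : (α, e) ∈ S
    · exact (heqS _ hS).symm
    · have ha0 : a (α, e) = 0 := by
        simp only [a, Fintype.card_eq_zero_iff]
        refine ⟨fun T => hS ?_⟩
        rw [hSdef, Finset.mem_image]
        exact ⟨T.1, Finset.mem_univ _, T.2⟩
      have h1 := hsum_b (insert (α, e) S)
      rw [Finset.sum_insert hS] at h1
      have h2 : ∑ ae ∈ S, b ae = n.factorial := by rw [← hsum_a]; exact (Finset.sum_congr rfl heqS).symm
      rw [ha0]
      omega
  -- unfold the notation
  have hfib : a (α, e) = Fintype.card {t : TableauPair n // TableauPair.content p t = α ∧ TableauPair.degree p t = e} :=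
    Fintype.card_congr (Equiv.subtypeEquivRight fun t => by simp only [f, Prod.mk.injEq])
  rw [← hfib, ← hgoal]

/-- **Discharge of the named fact `KLRGradedCellularBasis`** (Brundan–Kleshchev 2009, Hu–Mathas 2010,
Brundan–Kleshchev–Wang 2011: the graded cellular / `ψ`-basis of `𝔽_p S_n` at level one), through
`KLRGradedCellularBasis_of_finrank_gradedBlock` and the graded dimension formula
`finrank_gradedBlock_eq_card`. [cite: HuMathas2010, Main Theorem (Thm 49); BrundanKleshchev2009, Main Theorem] -/
theorem KLRGradedCellularBasis_holds : KLRGradedCellularBasis :=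
  KLRGradedCellularBasis_of_finrank_gradedBlock fun p _ n α e => finrank_gradedBlock_eq_card p n α e

end Counting





end Literature.RepresentationTheory.FiniteGroups
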